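import Literature.MathematicalPhysics.QuantumFieldTheory.Balaban1983to89.Beta.RemainderConstUpperDerived
import Literature.MathematicalPhysics.QuantumFieldTheory.Balaban1983to89.Beta.HessKerSchurCauchy

/-!
# `Balaban1983to89.Beta.RemainderConstAllScales` — the SCALAR ALL-SCALES currency `|β⁰_{k+j+1} − β⁰_{k+1}| ≤ κθ^k`
(all `k, j`) on the constant-remainder roads: a ONE-HOP floor `m − κθ^{k₁} ≤ β⁰_{k+1}` from a one-sided certified list,
with NO limit value, NO `0 ≤ θ`, NO `θ ≤ 1` ∕ `θ < 1` among the binders, joined BY NAME to the floor sockets of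
`Beta.RemainderConstCertified` ("RCC") and to the all-scales kernel currency of `Beta.HessKerSchurCauchy`
(β sub-cell of the audit cell `pub-balaban`, asymptotic lane asym2 «RemainderConst», journal node BETA-asym2-g18-ALLSCALES;
companion leaf of RCC ∕ `Beta.RemainderConstUpperDerived` ("RCUD"), same writer; a NEW LEAF — nothing in the tree is edited;
v1.1 docstring-only, v1.2 = + §7 append-only; see VERSIONS at the end of this header)

HONEST FRAMING (cell rule, verbatim, page 1 of everything the β sub-cell writes): discharging `BetaPertH` makes
Bałaban's UV stability UNCONDITIONAL — a real constructive-QFT result; it is NOT the continuum limit and NOT the Clay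
problem.  THIS MODULE DISCHARGES NOTHING of the series: it is `[folklore]` real analysis about an arbitrary real sequence
and an arbitrary split `β = β⁰ + β¹`, joining BY NAME hypothesis shapes and theorems already in the tree
(`Beta.RemainderConstCertified`, `Beta.RemainderConstUpperDerived`, `Beta.RateCertificate`, `Beta.LimitRate`,
`Beta.HessKerSchur`, `Beta.HessKerSchurCauchy`), none of which is modified.  Every analytic input — the all-scales bound
for Bałaban's one-loop kernels (the located, UNPRINTED estimate (CONV-C) in its all-scales "Cauchy" form, cell item
O-asym1-1), the certified list (lane cap), the remainder leaves (wall item (D4)), (C) (D5) — is a HYPOTHESIS BINDER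
labelled below; it instantiates NO binder of the wall `BetaPertH` and is NOT summit progress.

ABSOLUTE RULE (cell charter, verbatim): "No internally-minted statement may enter as a cited fact.  Every hypothesis is
either kernel-proved in this package or a verbatim quotation of a PUBLISHED theorem with page reference.  The
manuscript(s) under audit are NOT citable for their own disputed steps — they are the thing under adjudication;
programme-internal (2001/route/tribunal) claims are never citable."  The `[cite: …]` tags below are CONTEXT ONLY (they
say which printed display a hypothesis shape or a conclusion types); no tag imports a fact; no `def … : Prop` below is
a closed statement — `AllScalesSeq` is a PREDICATE with free arguments (a hypothesis shape), never asserted.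

CITATION HEADER (lean-in-tree rule 2026-08-18).  T. Bałaban, *Renormalization group approach to lattice gauge field
theories. I. Generation of effective actions in a small field approximation and a coupling constant renormalization in
four dimensions*, Commun. Math. Phys. **109**, 249–301 (1987) [Balaban1987RG1] (cell paper B12, [I]): p. 259 Theorem 2
with (0.31) (typed `B12.Thm2Printed`); p. 264 (1.22) (the one-loop coefficient, typed `B12Beta.secondMoment`) and §1
p. 263–264 (the shapes `FlowStep.BetaUpperH`, `FlowStep.BetaContH`); p. 268 (2.12)–(2.14) (the one-loop split, typed
`B12Beta.OneLoopSplit`); p. 293 (5.10) (typed `B12Sec2to5.Decay510`).  T. Bałaban, *Renormalization group approach to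
lattice gauge field theories. II. Cluster expansions*, Commun. Math. Phys. **116**, 1–22 (1988) [Balaban1988RG2Cluster]
(cell paper B13, [II]): p. 20 Lemma 3 (2.38); p. 21 "ε₁ sufficiently small" (before (2.40)).  CONTEXT ONLY for the SHAPE
of §1 (nothing of it is used): C. King, Commun. Math. Phys. **102**, 649–677 (1986) [King1986], Lemma 4.5 (4.38) p. 674 —
a bound on `C^{(k)}(x,y) − C^{(k+n)}(x,y)` by `C L^{−k} e^{−δ₀|x−y|}` UNIFORM IN `n`, the all-scales shape whose kernel form
is `HessKerSchurCauchy.AllScalesRate` (asym1) and whose scalar form is `AllScalesSeq` here.  NO `η = L^{−k} → 0`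
convergence statement for the coefficients (1.22), with or without rate, at one step or at all scales, and NO lower bound
`β ≥ b > 0` is printed in the series under audit: these stay located OPEN inputs and enter below only as binders.

## Why this module exists

Every constant-remainder road of RCC ∕ RCUD takes the one-loop rate in the TWO-ENDED form
`RateCertificate.GeomRate S.β0 binf c₀ θ` (`|β⁰_{k+1} − β⁰_∞| ≤ c₀θ^k`, `0 ≤ θ ≤ 1`, `binf` any real) or in the ONE-STEP
Cauchy form `CauchyRate S.β0 c θ` (`θ < 1`, constant inflated to `c/(1 − θ)`), and the cap × asym interlock floor is then
`m − c₀θ^{k₁}(1 + θ)` (RCC §7: from the certified depth `k₁` one hop to the limit and one hop back).  asym1's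
`Beta.HessKerSchurCauchy` (2026-08-19) made the kernel-level currency the ALL-SCALES shape
`|P_{k+j} − P_k| ≤ C′θ^k e^{−δ′|x|₁}` (all `j`), from which the two-ended rate follows with the SAME constant
(`AllScalesRate.geometricRate`, `θ < 1`).  At β-level the all-scales shape is worth keeping AS SUCH: the scalar bound
`|β⁰_{k+j+1} − β⁰_{k+1}| ≤ κθ^k` gives the floor `m − κθ^{k₁} ≤ β⁰_{k+1}` for EVERY `k` in ONE hop from the last certified
depth (`AllScalesSeq.lower_of_list`) — no limit value is named, and NO RANGE CONDITION ON `θ` is used (not even `0 ≤ θ`: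
the case `j = 0` of the hypothesis supplies `0 ≤ κθ^{k₁}`).  In particular `θ = 1` is allowed: a uniformly OSCILLATING,
NON-CONVERGENT one-loop sequence still yields Theorem 2 as printed on the constant road (§6, `Witness.splitOsc`, with
`not_geomRate_splitOsc`: no two-ended rate with `θ < 1` exists for it) — convergence of the coefficients (1.22) is not
what Theorem 2's lower constant needs; a certified depth plus a summable-or-not oscillation budget is.  The two tree
currencies map in with explicit constants: `CauchyRate c θ ⟹ AllScalesSeq (c/(1 − θ)) θ` (`0 ≤ θ < 1`; the resulting
Theorem-2 condition `r < m − (c/(1 − θ))θ^{k₁}` is SHARPER than RCC §7's Cauchy twin `r < m − (c/(1 − θ))θ^{k₁}(1 + θ)`),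
`GeomRate binf c₀ θ ⟹ AllScalesSeq (c₀(1 + θ)) θ` (`0 ≤ θ ≤ 1`; RCC §7's floor is recovered EXACTLY — kernel-checked
consistency `example`s in §4, no restatement).

## Content ([folklore] throughout; section numbers = the section headers below)

1. `AllScalesSeq b κ θ := ∀ k j, |b (k + j) − b k| ≤ κθ^k` and its algebra: `slack_nonneg`, `const_nonneg`, `mono`,
   `cauchyRate` (`j = 1`), `lower_of_list` ∕ `upper_of_list` (ONE-HOP floor ∕ ceiling from a one-sided list at depths
   `k ≤ k₁`, no θ-range), `floor_zero` ∕ `ceiling_zero` ∕ `abs_le` (`k₁ = 0`), `pos_all_of_list`; the limit side (scalar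
   twin of `HessKerSchurCauchy.AllScalesRate.geometricRate`): `geomRate_of_tendsto` (ANY limit value, SAME `κ`, no
   θ-range) and `geomRate` (`θ < 1`: `GeomRate b (CauchyRate.lim b) κ θ`, SAME `κ` — compare `CauchyRate.geomRate`'s
   `c/(1 − θ)`); the conversions `allScalesSeq_of_cauchyRate` (`κ = c/(1 − θ)`), `allScalesSeq_of_geomRate`
   (`κ = c₀(1 + θ)`).
2. β-LEVEL (RCC §2 ∕ §3 sockets BY NAME, threshold scale `k₀ = 0`, box `]0,γ₀]` NOT shrunk): `betaLowerH_of_allScalesConst`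
   (`β_{k+1} ≥ m − κθ^{k₁} − r` on every box), `beta_pos_all_…`, `allScalesGap_…` (`κθ^{k₁} < m` is implied, `r ≥ 0`),
   `beta0_pos_all_…`; (U) DERIVED `betaUpperH_of_allScales_const` (`β′ = β⁰_1 + κ + r`, RCUD §2 socket);
   `eventualFormOfAllScalesConst` (+ `_consts`), `endpointExistence_…`, `thm2Printed_…`, `betaAFH_…`,
   `thm2_fineLattices_…` and the `hup`-free `_cont` twins.  The SINGLE numeric condition is `r < m − κθ^{k₁}`.
3. CHAIN LEVEL (remainder slot filled by the printed chain, leaves as fields; wall item (D4)):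
   `thm2Printed_of_allScalesChainL` ∕ `…ChainT` ∕ `…ChainL_elem`, `endpointExistence_of_allScalesChainL`, their `_cont`
   twins, `exists_eps1_lt_allScales` (the condition `ε₁·K_rem,L < m − κθ^{k₁}` is a satisfiable NUMERIC restriction of the
   printed type "ε₁ sufficiently small" once `κθ^{k₁} < m`).
4. FROM THE TREE'S RATE CURRENCIES: the sharper Cauchy road `betaLowerH_∕thm2Printed_of_cauchyAllScalesConst` (+ `_cont`);
   RCC §7 recovered from `allScalesSeq_of_geomRate` (`example`s only).
5. KERNEL SIDE: `allScalesSeq_secondMoment_of_summable` ∕ `allScalesSeq_secondMoment` ((UD) + `AllScalesRate` ⟹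
   `AllScalesSeq (k ↦ secondMoment (P k) μ ν) (betaPrime510 D C′ δ′) θ`, dominated summation of (1.22) against the
   all-scales majorant; NO θ-range, NO limit kernel); the `hessKer` ENDs of `HessKerSchurCauchy` §2–§5 in scalar
   all-scales form with THE TREE'S constants and without `0 ≤ θ < 1` ∕ `limKernelOf`
   (`allScalesSeq_secondMoment_hessKer_halfV` ∕ `_primitivesW` ∕ `_operatorsW` ∕ `_primitivesW_of_pointwise`); the joined
   END `thm2Printed_of_allScalesRateConst` (+ `_cont`, `endpointExistence_of_allScalesRateConst_cont`) under the
   identification `S.β0 k = secondMoment (P k) μ ν` ((1.22) at zero couplings).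
6. NON-VACUITY with genuinely scale-dependent one-loop coefficients: on RCC's `Witness.splitGeom` (`β⁰_{k+1} = 1 + 2^{−k}`)
   the all-scales floor at depth `k₁ = 1` is `1/2`, versus `1/4` on the margin road (`Witness.floors_compared`); on the
   OSCILLATING split `Witness.splitOsc` (`β⁰_{k+1} = 1 + (−1)^k/4`, `θ = 1`, `κ = 1/2`) the road yields `BetaAFH` and the
   END carrier although NO `GeomRate` with `0 ≤ θ < 1` holds (`Witness.not_geomRate_splitOsc`).
7. (v1.2) THE END-GRADE CONTENT OF THE ALL-SCALES HYPOTHESIS: `TailDrop b k₁ s := ∀ n ≥ k₁, b k₁ − s ≤ b n` (one level, one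
   side, no `θ`, no limit); `TailDrop.floor_of_list` (`m − s ≤ b k` for every `k` from the one-sided list of depth `k₁`);
   `AllScalesSeq.tailDrop : AllScalesSeq b κ θ → TailDrop b k₁ (κθ^{k₁})` (ALL that `lower_of_list` uses of the all-scales
   hypothesis), `tailDrop_of_geomRate` (budget `c₀(1+θ)θ^{k₁}`: RCC §7's margin floor), `tailDrop_of_cauchyRate` (budget
   `(c/(1−θ))θ^{k₁}`); the β-level ∕ END sockets of RCC fed with it — `betaLowerH_∕betaAFH_∕thm2Printed_∕endpointExistence_of_tailDropConst`
   (ONE condition `r < m − s`) and `thm2Printed_of_tailDropCeilingConst` ((U) DERIVED from a level ceiling `β⁰ ≤ M` through RCUD);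
   §2 re-derived as the case `s = κθ^{k₁}`, `M = β⁰_1 + κ` (`example`s); witness: on `splitOsc` the tail drop at depth 1 (a
   trough) has budget `0` and gives `BetaAFH` with constant `3/4` from the deeper list (`Witness.betaAFH_oscFamily_tailDrop`).  So at
   END grade the located-unprinted input of the all-scales × constant road is a ONE-SIDED TAIL-DROP bound at the certified depth
   (+ a level ceiling when (U) is derived) — strictly weaker than `AllScalesRate` ∕ `CauchyRate` ∕ `GeomRate`, which remain what
   the KERNEL side (§5) delivers (advisory A-lit1g23-1 of the transfer seat's read of `AveragedAFCarrierAllScales`, typed).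

WHAT IS NOT HERE: no all-scales bound, (UD), certified value, remainder leaf or (C) for Bałaban's kernels is proved or
asserted (all binders; the all-scales data for the rescaled constituents is O-asym1-1, supplier-side, not in print); no
statement about `BetaPertH`, `betaPositive`, the continuum limit or the Clay problem.

VERSIONS.  v1: asym2 generation 18 (p191686).  v1.1 (this file): same generation, DOCSTRING-ONLY — every declaration
byte-identical to v1; (D1) the context-only King locator above now reads «Commun. Math. Phys. **102**, 649–677 (1986)»
(= *The U(1) Higgs model. I. The continuum limit*, whose p. 674 carries Lemma 4.5 (4.38); v1 printed the volume and page
range of Part II, CMP 103, 323–349, under the right key, lemma and page — the cell-wide «King 1986 locator slip», found by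
the literature seat t4-lit2 and confirmed by the three independent reads of v1 (cell records GAPS A-t4lit2g11-1 (5),
C-asym1g10-2 ∕ -3, C-an4-45, C-pv20-67); nothing of King's paper is used, so no kernel content was affected); (I1) one
prose remark added to the docstring of `AllScalesSeq.geomRate` (the name of the limit); this paragraph and one clause of the
title block are the only other changes.  v1.2 (this file): same generation, APPEND-ONLY — every declaration of §§1–6
byte-identical to v1.1 (hence to v1); + §7 (the tail-drop road: 1 def, 17 theorems, 2 consistency `example`s, [folklore]
compositions into RCC ∕ RCUD sockets) typing advisory A-lit1g23-1; besides §7 only Content item 7, this sentence and the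
title-block clause change.
-/

namespace Literature.MathematicalPhysics.QuantumFieldTheory.Balaban1983to89.Beta.RemainderConstAllScales

open Filter
open scoped _root_.Topology
open Literature.MathematicalPhysics.QuantumFieldTheory.Balaban1983to89
open FlowStep DagBinding FlowStepRuns
open Literature.MathematicalPhysics.QuantumFieldTheory.Balaban1983to89.Beta.Assembly
open Literature.MathematicalPhysics.QuantumFieldTheory.Balaban1983to89.Beta.RemainderChain
open Literature.MathematicalPhysics.QuantumFieldTheory.Balaban1983to89.Beta.RemainderChainLattice
open Literature.MathematicalPhysics.QuantumFieldTheory.Balaban1983to89.Beta.RemainderChainTorus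
open Literature.MathematicalPhysics.QuantumFieldTheory.Balaban1983to89.Beta.RemainderConstNumerals (elemCoeffL)
open Literature.MathematicalPhysics.QuantumFieldTheory.Balaban1983to89.Beta.RateCertificate
open Literature.MathematicalPhysics.QuantumFieldTheory.Balaban1983to89.Beta.RemainderConstCertified
open Literature.MathematicalPhysics.QuantumFieldTheory.Balaban1983to89.Beta.RemainderConstUpperDerived
open Literature.MathematicalPhysics.QuantumFieldTheory.Balaban1983to89.B12Sec2to5 (l1 Decay510 betaPrime510
  secondMoment_abs_le_of_decay510)
open LimitRate (subKernel subKernel_apply secondMoment_subKernel)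
open ExpKernelCalculus (MKer Decays VertexFamily₂ hessKer comp Zl)
open HessKerSchur (ColW VertexFamilyW VertexFamily₂W lipW LocStencilW colW_of_decays locStencilW_of_locStencil
  vertexFamily₂W_of_vertexFamily₂ uniformDecay_hessKer_halfV vertexFamilyW_vertexOfK)
open HessKerSchurResolvent (idK)
open HessKerSchurCauchy (AllScalesRate allScalesRate_hessKer_halfV vertexFamilyW_vertexOfK_allScales
  colW_resolvent_allScales)
open OneStepResolventKernel (Fib LocStencil)
open OneStepKernelFamily (vertexOfK)

noncomputable section

/-! ## 1. The scalar all-scales shape and its algebra -/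

/-- HYPOTHESIS SHAPE (AF-0r, ALL-SCALES form): `|b_{k+j} − b_k| ≤ κ·θ^k` for ALL `k, j` — what a comparison of the
scale-`(k+j+1)` and scale-`(k+1)` one-loop data delivers when the suppliers' rate is stated between any two levels (the
scalar form of `HessKerSchurCauchy.AllScalesRate`; King's `C^{(k)} − C^{(k+n)}` shape).  A PREDICATE with free
constants; no limit value is named; no range of `θ` is part of it.  Located, NOT printed, for (1.22).
[cite: Balaban1987RG1, (1.22) p.264] -/
def AllScalesSeq (b : ℕ → ℝ) (κ θ : ℝ) : Prop :=
  ∀ k j, |b (k + j) - b k| ≤ κ * θ ^ k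

namespace AllScalesSeq

variable {b : ℕ → ℝ} {κ θ : ℝ}

/-- The slack at every depth is `≥ 0` (take `j = 0`). [folklore] -/
theorem slack_nonneg (h : AllScalesSeq b κ θ) (k : ℕ) : 0 ≤ κ * θ ^ k := by
  simpa using h k 0

/-- The constant is `≥ 0` (take `k = j = 0`). [folklore] -/
theorem const_nonneg (h : AllScalesSeq b κ θ) : 0 ≤ κ := by
  simpa using h.slack_nonneg 0

/-- Monotone in the constant (for `0 ≤ θ`). [folklore] -/
theorem mono (h : AllScalesSeq b κ θ) {κ' : ℝ} (hκ : κ ≤ κ') (hθ0 : 0 ≤ θ) : AllScalesSeq b κ' θ := fun k j =>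
  (h k j).trans (mul_le_mul_of_nonneg_right hκ (pow_nonneg hθ0 k))

/-- Symmetric reading `|b_k − b_{k+j}| ≤ κθ^k`. [folklore] -/
theorem abs_sub_le (h : AllScalesSeq b κ θ) (k j : ℕ) : |b k - b (k + j)| ≤ κ * θ ^ k := by
  rw [abs_sub_comm]; exact h k j

/-- The bound between the depth `k` and ANY later index `n ≥ k`. [folklore] -/
theorem abs_sub_le_of_le (h : AllScalesSeq b κ θ) {k n : ℕ} (hkn : k ≤ n) : |b n - b k| ≤ κ * θ ^ k := by
  obtain ⟨j, rfl⟩ := Nat.exists_eq_add_of_le hkn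
  exact h k j

/-- All-scales ⟹ one-step (`j = 1`), SAME constants: `RateCertificate.CauchyRate b κ θ`. [folklore] -/
theorem cauchyRate (h : AllScalesSeq b κ θ) : CauchyRate b κ θ := fun k => h k 1

/-- Two sequences that agree termwise carry the same all-scales bound. [folklore] -/
theorem congr (h : AllScalesSeq b κ θ) {b' : ℕ → ℝ} (hb : ∀ k, b' k = b k) : AllScalesSeq b' κ θ := fun k j => by
  rw [hb, hb]; exact h k j

/-- **THE ONE-HOP FLOOR from a ONE-SIDED certified list**: `m ≤ b_k` for `k ≤ k₁` ⟹ `m − κθ^{k₁} ≤ b_k` for EVERY `k`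
(for `k ≤ k₁` by `0 ≤ κθ^{k₁}`; for `k ≥ k₁` by `|b_k − b_{k₁}| ≤ κθ^{k₁}`).  NO range condition on `θ`, NO limit value —
compare `RateCertificate.GeomRate.lower_of_list` (`0 ≤ θ ≤ 1`, floor `m − c₀θ^{k₁}(1 + θ)`: two hops through `b_∞`). [folklore] -/
theorem lower_of_list (h : AllScalesSeq b κ θ) {k₁ : ℕ} {m : ℝ} (hlist : ∀ k, k ≤ k₁ → m ≤ b k) :
    ∀ k, m - κ * θ ^ k₁ ≤ b k := fun k =>
  (le_or_gt k k₁).elim (fun hk => by linarith [hlist k hk, h.slack_nonneg k₁]) fun hk => by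
    have h1 := (abs_le.mp (h.abs_sub_le_of_le hk.le)).1
    linarith [hlist k₁ le_rfl]

/-- The dual ONE-HOP CEILING from a one-sided UPPER list: `b_k ≤ M` for `k ≤ k₁` ⟹ `b_k ≤ M + κθ^{k₁}` for every `k`. [folklore] -/
theorem upper_of_list (h : AllScalesSeq b κ θ) {k₁ : ℕ} {M : ℝ} (hlist : ∀ k, k ≤ k₁ → b k ≤ M) :
    ∀ k, b k ≤ M + κ * θ ^ k₁ := fun k =>
  (le_or_gt k k₁).elim (fun hk => by linarith [hlist k hk, h.slack_nonneg k₁]) fun hk => by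
    have h1 := (abs_le.mp (h.abs_sub_le_of_le hk.le)).2
    linarith [hlist k₁ le_rfl]

/-- Depth-zero floor: `b_0 − κ ≤ b_k` for every `k`. [folklore] -/
theorem floor_zero (h : AllScalesSeq b κ θ) : ∀ k, b 0 - κ ≤ b k := by
  simpa using h.lower_of_list (k₁ := 0) (m := b 0) (fun k hk => by rw [Nat.le_zero.mp hk])

/-- Depth-zero ceiling: `b_k ≤ b_0 + κ` for every `k` (feeds RCUD's (U)-DERIVED socket `betaUpperH_of_ceiling_const`). [folklore] -/
theorem ceiling_zero (h : AllScalesSeq b κ θ) : ∀ k, b k ≤ b 0 + κ := by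
  simpa using h.upper_of_list (k₁ := 0) (M := b 0) (fun k hk => by rw [Nat.le_zero.mp hk])

/-- Band: `|b_k| ≤ |b_0| + κ` for every `k`. [folklore] -/
theorem abs_le (h : AllScalesSeq b κ θ) : ∀ k, |b k| ≤ |b 0| + κ := fun k => by
  have h1 := h 0 k
  rw [Nat.zero_add, pow_zero, mul_one] at h1
  calc |b k| = |(b k - b 0) + b 0| := by rw [sub_add_cancel]
    _ ≤ |b k - b 0| + |b 0| := abs_add_le _ _
    _ ≤ |b 0| + κ := by linarith

/-- Positivity of EVERY term from the one-sided list and the gap `κθ^{k₁} < m`. [folklore] -/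
theorem pos_all_of_list (h : AllScalesSeq b κ θ) {k₁ : ℕ} {m : ℝ} (hlist : ∀ k, k ≤ k₁ → m ≤ b k)
    (hgap : κ * θ ^ k₁ < m) : ∀ k, 0 < b k := fun k => by
  have := h.lower_of_list hlist k
  linarith

/-- **ALL-SCALES ⟹ two-ended rate about ANY limit value, SAME constant, NO θ-range**: if `b_k → a` then
`|b_k − a| ≤ κθ^k` (let `j → ∞` in `|b_k − b_{k+j}| ≤ κθ^k`, `le_of_tendsto`) — the scalar twin of
`HessKerSchurCauchy.AllScalesRate.geometricRate`. [folklore] -/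
theorem geomRate_of_tendsto (h : AllScalesSeq b κ θ) {a : ℝ} (ha : Tendsto b atTop (𝓝 a)) : GeomRate b a κ θ := fun k => by
  have hs : Tendsto (fun j => b (k + j)) atTop (𝓝 a) :=
    ((tendsto_add_atTop_iff_nat k).mpr ha).congr fun j => by rw [Nat.add_comm]
  have ht : Tendsto (fun j => |b k - b (k + j)|) atTop (𝓝 |b k - a|) := (tendsto_const_nhds.sub hs).abs
  exact le_of_tendsto ht (Eventually.of_forall fun j => h.abs_sub_le k j)

/-- Under `θ < 1` the sequence converges to the constructed limit `CauchyRate.lim b` (via `j = 1`). [folklore] -/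
theorem tendsto_lim (h : AllScalesSeq b κ θ) (hθ1 : θ < 1) : Tendsto b atTop (𝓝 (CauchyRate.lim b)) :=
  h.cauchyRate.tendsto_lim hθ1

/-- **ALL-SCALES ⟹ `GeomRate b (lim b) κ θ` with the SAME `κ`** (`θ < 1`; compare `CauchyRate.geomRate`: `c/(1 − θ)`).
(v1.1 remark, I1 of the owner-side read of v1: `CauchyRate.lim b` is merely THE NAME chosen for the limit; by uniqueness of
limits in `ℝ` (`tendsto_nhds_unique`) it equals any other limit value of `b` — e.g. `secondMoment (limKernelOf P …) μ ν` in
the conclusions of `HessKerSchurCauchy`'s ENDs when `b k = secondMoment (P k) μ ν` — and `geomRate_of_tendsto` serves any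
named limit directly; no consumer in the tree needs the identification.) [folklore] -/
theorem geomRate (h : AllScalesSeq b κ θ) (hθ1 : θ < 1) : GeomRate b (CauchyRate.lim b) κ θ :=
  h.geomRate_of_tendsto (h.tendsto_lim hθ1)

end AllScalesSeq

/-- **ONE-STEP (Cauchy) ⟹ ALL-SCALES with `κ = c/(1 − θ)`** (`0 ≤ θ < 1`): the geometric series between the two levels,
`|b_{k+j} − b_k| ≤ (c/(1 − θ))(θ^k − θ^{k+j}) ≤ (c/(1 − θ))θ^k`. [folklore] -/
theorem allScalesSeq_of_cauchyRate {b : ℕ → ℝ} {c θ : ℝ} (h : CauchyRate b c θ) (hθ0 : 0 ≤ θ) (hθ1 : θ < 1) :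
    AllScalesSeq b (c / (1 - θ)) θ := by
  have h1θ : (1 - θ) ≠ 0 := (sub_pos.mpr hθ1).ne'
  have hcκ : c / (1 - θ) * (1 - θ) = c := div_mul_cancel₀ c h1θ
  have hc : 0 ≤ c / (1 - θ) := div_nonneg h.const_nonneg (sub_pos.mpr hθ1).le
  have key : ∀ k j, |b (k + j) - b k| ≤ c / (1 - θ) * (θ ^ k - θ ^ (k + j)) := by
    intro k j
    induction j with
    | zero => simp
    | succ j ih =>
      have h1 : |b (k + j + 1) - b (k + j)| ≤ c / (1 - θ) * (1 - θ) * θ ^ (k + j) := by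
        rw [hcκ]; exact h (k + j)
      calc |b (k + (j + 1)) - b k| = |(b (k + j + 1) - b (k + j)) + (b (k + j) - b k)| := by
            rw [sub_add_sub_cancel, ← Nat.add_assoc]
        _ ≤ |b (k + j + 1) - b (k + j)| + |b (k + j) - b k| := abs_add_le _ _
        _ ≤ c / (1 - θ) * (1 - θ) * θ ^ (k + j) + c / (1 - θ) * (θ ^ k - θ ^ (k + j)) := add_le_add h1 ih
        _ = c / (1 - θ) * (θ ^ k - θ ^ (k + (j + 1))) := by rw [← Nat.add_assoc, pow_succ]; ring
  intro k j
  calc |b (k + j) - b k| ≤ c / (1 - θ) * (θ ^ k - θ ^ (k + j)) := key k j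
    _ ≤ c / (1 - θ) * θ ^ k := mul_le_mul_of_nonneg_left (by linarith [pow_nonneg hθ0 (k + j)]) hc

/-- **TWO-ENDED ⟹ ALL-SCALES with `κ = c₀(1 + θ)`** (`0 ≤ θ ≤ 1`; for `j ≥ 1`, `|b_{k+j} − b_k| ≤ c₀θ^{k+j} + c₀θ^k ≤
c₀θ^k(θ + 1)`) — so RCC §7's floor `m − c₀θ^{k₁}(1 + θ)` is `AllScalesSeq.lower_of_list` at this `κ` (§4). [folklore] -/
theorem allScalesSeq_of_geomRate {b : ℕ → ℝ} {binf c₀ θ : ℝ} (h : GeomRate b binf c₀ θ) (hθ0 : 0 ≤ θ) (hθ1 : θ ≤ 1) :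
    AllScalesSeq b (c₀ * (1 + θ)) θ := fun k j => by
  have hc := h.const_nonneg
  cases j with
  | zero =>
    have : 0 ≤ c₀ * (1 + θ) * θ ^ k := mul_nonneg (mul_nonneg hc (by linarith)) (pow_nonneg hθ0 k)
    simpa using this
  | succ i =>
    have hki : θ ^ (k + i) ≤ θ ^ k := by
      rw [pow_add]; exact mul_le_of_le_one_right (pow_nonneg hθ0 k) (pow_le_one₀ hθ0 hθ1)
    have hpow : θ ^ (k + (i + 1)) ≤ θ ^ k * θ := by
      rw [← Nat.add_assoc, pow_succ]; exact mul_le_mul_of_nonneg_right hki hθ0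
    have h1 : |b (k + (i + 1)) - binf| ≤ c₀ * (θ ^ k * θ) := (h (k + (i + 1))).trans (mul_le_mul_of_nonneg_left hpow hc)
    have h0 := h k
    calc |b (k + (i + 1)) - b k| = |(b (k + (i + 1)) - binf) - (b k - binf)| := by rw [sub_sub_sub_cancel_right]
      _ ≤ |b (k + (i + 1)) - binf| + |b k - binf| := abs_sub _ _
      _ ≤ c₀ * (θ ^ k * θ) + c₀ * θ ^ k := add_le_add h1 h0
      _ = c₀ * (1 + θ) * θ ^ k := by ring

/-! ## 2. β-level: the one-hop floor × the constant-form remainder (RCC §2 ∕ §3 sockets by name) -/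

variable {β : HBeta} {d : ℕ}

/-- **(AF-0) on ALL boxes, all-scales × constant**: `AllScalesSeq S.β0 κ θ`, the one-sided certified list `m ≤ β⁰_{k+1}`
(`k ≤ k₁`) and `RemainderConst S γ₀ r` give `β_{k+1} ≥ m − κθ^{k₁} − r` on `]0,γ₀]^{k+1}` for EVERY `k`
(`AllScalesSeq.lower_of_list` ∘ `RemainderConstCertified.betaLowerH_of_floor_const`).  No θ-range, no limit.
[cite: Balaban1987RG1, (2.12)–(2.14) p.268] -/
theorem betaLowerH_of_allScalesConst (S : B12Beta.OneLoopSplit β) {γ₀ κ θ r m : ℝ} {k₁ : ℕ}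
    (hall : AllScalesSeq S.β0 κ θ) (hlist : ∀ k, k ≤ k₁ → m ≤ S.β0 k) (hrem : RemainderConst S γ₀ r) :
    BetaLowerH (m - κ * θ ^ k₁ - r) γ₀ β :=
  betaLowerH_of_floor_const S (hall.lower_of_list hlist) hrem

/-- … hence `β_{k+1} > 0` on every `]0,γ₀]`-box under the SINGLE condition `r < m − κθ^{k₁}`. [folklore] -/
theorem beta_pos_all_of_allScalesConst (S : B12Beta.OneLoopSplit β) {γ₀ κ θ r m : ℝ} {k₁ : ℕ}
    (hall : AllScalesSeq S.β0 κ θ) (hlist : ∀ k, k ≤ k₁ → m ≤ S.β0 k) (hrem : RemainderConst S γ₀ r)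
    (hr : r < m - κ * θ ^ k₁) : ∀ k, ∀ v ∈ Box γ₀ k, 0 < β k v := fun k v hv => by
  have := betaLowerH_of_allScalesConst S hall hlist hrem k v hv
  linarith

/-- The gap `κθ^{k₁} < m` is implied on the constant road (`0 ≤ r` on non-empty boxes). [folklore] -/
theorem allScalesGap_of_allScalesConst (S : B12Beta.OneLoopSplit β) {γ₀ κ θ r m : ℝ} {k₁ : ℕ} (hγ₀ : 0 < γ₀)
    (hrem : RemainderConst S γ₀ r) (hr : r < m - κ * θ ^ k₁) : κ * θ ^ k₁ < m := by
  have := remainderConst_nonneg S hγ₀ hrem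
  linarith

/-- … so every one-loop coefficient is positive as well (never used by the END roads; recorded). [folklore] -/
theorem beta0_pos_all_of_allScalesConst (S : B12Beta.OneLoopSplit β) {γ₀ κ θ r m : ℝ} {k₁ : ℕ} (hγ₀ : 0 < γ₀)
    (hall : AllScalesSeq S.β0 κ θ) (hlist : ∀ k, k ≤ k₁ → m ≤ S.β0 k) (hrem : RemainderConst S γ₀ r)
    (hr : r < m - κ * θ ^ k₁) : ∀ k, 0 < S.β0 k :=
  hall.pos_all_of_list hlist (allScalesGap_of_allScalesConst S hγ₀ hrem hr)

/-- **(U) DERIVED on the all-scales road**: `AllScalesSeq S.β0 κ θ` and `RemainderConst S γ₀ r` give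
`FlowStep.BetaUpperH (β⁰_1 + κ + r) γ₀ β` (`AllScalesSeq.ceiling_zero` ∘ RCUD's `betaUpperH_of_ceiling_const`) — the
printed-type upper bound is not an independent input here either; no θ-range. [cite: Balaban1987RG1, (2.12)–(2.14) p.268] -/
theorem betaUpperH_of_allScales_const (S : B12Beta.OneLoopSplit β) {γ₀ κ θ r : ℝ} (hall : AllScalesSeq S.β0 κ θ)
    (hrem : RemainderConst S γ₀ r) : BetaUpperH (S.β0 0 + κ + r) γ₀ β :=
  betaUpperH_of_ceiling_const S hall.ceiling_zero hrem

/-- **The minimal carrier `Assembly.EventualForm β`, all-scales × constant**: `b = m − κθ^{k₁} − r`, threshold scale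
`k₀ = 0`, box `]0,γ₀]` UNCHANGED, `β′` the printed upper constant; the lower companion `−β′ ≤ β_{k+1}` is DERIVED.
[cite: Balaban1987RG1, §1 p.264 and (2.12)–(2.14) p.268] -/
def eventualFormOfAllScalesConst (S : B12Beta.OneLoopSplit β) {γ₀ κ θ r β' m : ℝ} {k₁ : ℕ} (hγ₀ : 0 < γ₀)
    (hall : AllScalesSeq S.β0 κ θ) (hlist : ∀ k, k ≤ k₁ → m ≤ S.β0 k) (hrem : RemainderConst S γ₀ r)
    (hr : r < m - κ * θ ^ k₁) (hup : BetaUpperH β' γ₀ β) (hcont : BetaContH γ₀ β) : EventualForm β :=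
  eventualFormOfFloorConst S (k₀ := 0) hγ₀ (fun k _ => hall.lower_of_list hlist k) hrem hr hup
    (fun k v hv => by
      have h1 := betaLowerH_of_allScalesConst S hall hlist hrem k v hv
      have h2 := hup k v hv
      linarith)
    hcont

/-- Its constants: `b = m − κθ^{k₁} − r`, `k₀ = 0`, box `γ₀` (not shrunk), `β′`. [folklore] -/
theorem eventualFormOfAllScalesConst_consts (S : B12Beta.OneLoopSplit β) {γ₀ κ θ r β' m : ℝ} {k₁ : ℕ}
    (hγ₀ : 0 < γ₀) (hall : AllScalesSeq S.β0 κ θ) (hlist : ∀ k, k ≤ k₁ → m ≤ S.β0 k) (hrem : RemainderConst S γ₀ r)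
    (hr : r < m - κ * θ ^ k₁) (hup : BetaUpperH β' γ₀ β) (hcont : BetaContH γ₀ β) :
    (eventualFormOfAllScalesConst S hγ₀ hall hlist hrem hr hup hcont).b = m - κ * θ ^ k₁ - r ∧
      (eventualFormOfAllScalesConst S hγ₀ hall hlist hrem hr hup hcont).k₀ = 0 ∧
      (eventualFormOfAllScalesConst S hγ₀ hall hlist hrem hr hup hcont).γ₀ = γ₀ ∧
      (eventualFormOfAllScalesConst S hγ₀ hall hlist hrem hr hup hcont).β' = β' :=
  ⟨rfl, rfl, rfl, rfl⟩

/-- **THE END STATEMENT `DagBinding.EndpointExistence C`, all-scales × constant** (forward-generated constructions):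
all-scales bound + one-sided list + constant remainder + the one condition + (U) + (C). [cite: Balaban1987RG1, Thm 2 p.259 (first sentence)] -/
theorem endpointExistence_of_allScalesConst {C : B12.Construction} (hgen : ForwardGenerated C β)
    (S : B12Beta.OneLoopSplit β) {γ₀ κ θ r β' m : ℝ} {k₁ : ℕ} (hγ₀ : 0 < γ₀) (hall : AllScalesSeq S.β0 κ θ)
    (hlist : ∀ k, k ≤ k₁ → m ≤ S.β0 k) (hrem : RemainderConst S γ₀ r) (hr : r < m - κ * θ ^ k₁)
    (hup : BetaUpperH β' γ₀ β) (hcont : BetaContH γ₀ β) : EndpointExistence C :=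
  (eventualFormOfAllScalesConst S hγ₀ hall hlist hrem hr hup hcont).endpointExistence hgen

/-- **THEOREM 2 AS PRINTED, ALL-SCALES × CONSTANT.**  Inputs: the DAG (`ForwardGenerated`), `1 < L`; the printed split `S`;
(asym, all-scales) `AllScalesSeq S.β0 κ θ` — NO range of `θ`, NO limit value; (cap) ONE-SIDED certified lower values
`m ≤ β⁰_{k+1}` for `k ≤ k₁`; (asym2 ∕ an4) `RemainderConst S γ₀ r`; the ONE numeric condition `r < m − κθ^{k₁}`; (C); (U).
Lower constant of (0.31): `(m − κθ^{k₁} − r)/log L` on the FULL box `]0,γ₀]`.  Binder list = RCC §7's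
`thm2Printed_of_marginConst` with `(hθ0, hθ1, hconv)` ↦ `hall` and the floor sharpened from `m − c₀θ^{k₁}(1 + θ)`.
[cite: Balaban1987RG1, Thm 2 p.259 with (0.31)] -/
theorem thm2Printed_of_allScalesConst {C : B12.Construction} (hgen : ForwardGenerated C β) {L : ℝ} (hL : 1 < L)
    (S : B12Beta.OneLoopSplit β) {γ₀ κ θ r β' m : ℝ} {k₁ : ℕ} (hγ₀ : 0 < γ₀) (hall : AllScalesSeq S.β0 κ θ)
    (hlist : ∀ k, k ≤ k₁ → m ≤ S.β0 k) (hrem : RemainderConst S γ₀ r) (hr : r < m - κ * θ ^ k₁)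
    (hcont : BetaContH γ₀ β) (hup : BetaUpperH β' γ₀ β) : B12.Thm2Printed C L :=
  thm2Printed_of_floor_const hgen hL S hγ₀ (hall.lower_of_list hlist) hrem hr hcont hup

/-- **Discrete asymptotic freedom `BetaAFH β`, all-scales × constant** (witness box `γ₀` itself, constant `m − κθ^{k₁} − r`).
[folklore] -/
theorem betaAFH_of_allScalesConst (S : B12Beta.OneLoopSplit β) {γ₀ κ θ r m : ℝ} {k₁ : ℕ} (hγ₀ : 0 < γ₀)
    (hall : AllScalesSeq S.β0 κ θ) (hlist : ∀ k, k ≤ k₁ → m ≤ S.β0 k) (hrem : RemainderConst S γ₀ r)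
    (hr : r < m - κ * θ ^ k₁) : BetaAFH β :=
  betaAFH_of_floor_const S hγ₀ (hall.lower_of_list hlist) hrem hr

/-- **The lower half of (0.31) on FINE lattices, all-scales × constant — WITH NO THRESHOLD** (`k₀ = 0`: every number of
steps `K`, every `0 < g ≤ γ ≤ γ₀`; (0.31)-constant `b/2`, `b = m − κθ^{k₁} − r`). [cite: Balaban1987RG1, Thm 2 (0.31) p.259] -/
theorem thm2_fineLattices_of_allScalesConst {C : B12.Construction} (hgen : ForwardGenerated C β)
    (S : B12Beta.OneLoopSplit β) {γ₀ κ θ r β' m : ℝ} {k₁ : ℕ} (hγ₀ : 0 < γ₀) (hall : AllScalesSeq S.β0 κ θ)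
    (hlist : ∀ k, k ≤ k₁ → m ≤ S.β0 k) (hrem : RemainderConst S γ₀ r) (hr : r < m - κ * θ ^ k₁)
    (hup : BetaUpperH β' γ₀ β) (hcont : BetaContH γ₀ β) :
    ∀ (n : ℕ) (γ : ℝ), 0 < γ → γ ≤ γ₀ → ∀ g : ℝ, 0 < g → g ≤ γ → ∀ K : ℕ,
      ∃ g0 : ℝ, (C ⟨K, n, g0⟩).flow.InInterval γ K ∧ (C ⟨K, n, g0⟩).flow.g K = g ∧
        Step.Discrete031 ((m - κ * θ ^ k₁ - r) / 2) β' K g (C ⟨K, n, g0⟩).flow.g := by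
  intro n γ hγ hγle g hg hgγ K
  refine (eventualFormOfAllScalesConst S hγ₀ hall hlist hrem hr hup hcont).thm2_fineLattices hgen n γ hγ hγle g hg ?_
    K ?_
  · show 1 / γ ^ 2 + β' * ((0 : ℕ) : ℝ) ≤ 1 / g ^ 2
    rw [Nat.cast_zero, mul_zero, add_zero]
    exact one_div_le_one_div_of_le (pow_pos hg 2) (pow_le_pow_left₀ hg.le hgγ 2)
  · show (3 * (m - κ * θ ^ k₁ - r) + 2 * β') * ((0 : ℕ) : ℝ) ≤ (m - κ * θ ^ k₁ - r) * K
    rw [Nat.cast_zero, mul_zero]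
    exact mul_nonneg (by linarith) (Nat.cast_nonneg K)

/-- **END on the all-scales road, (U) DERIVED** (`β′ = β⁰_1 + κ + r`): no `hup`. [cite: Balaban1987RG1, Thm 2 p.259 (first sentence)] -/
theorem endpointExistence_of_allScalesConst_cont {C : B12.Construction} (hgen : ForwardGenerated C β)
    (S : B12Beta.OneLoopSplit β) {γ₀ κ θ r m : ℝ} {k₁ : ℕ} (hγ₀ : 0 < γ₀) (hall : AllScalesSeq S.β0 κ θ)
    (hlist : ∀ k, k ≤ k₁ → m ≤ S.β0 k) (hrem : RemainderConst S γ₀ r) (hr : r < m - κ * θ ^ k₁)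
    (hcont : BetaContH γ₀ β) : EndpointExistence C :=
  endpointExistence_of_allScalesConst hgen S hγ₀ hall hlist hrem hr (betaUpperH_of_allScales_const S hall hrem) hcont

/-- **THEOREM 2 AS PRINTED on the all-scales road, (U) DERIVED** — no `hup`; binders: DAG, `1 < L`, `S`, `hall`, `hlist`,
`hrem`, `hr`, (C). [cite: Balaban1987RG1, Thm 2 p.259 with (0.31)] -/
theorem thm2Printed_of_allScalesConst_cont {C : B12.Construction} (hgen : ForwardGenerated C β) {L : ℝ} (hL : 1 < L)
    (S : B12Beta.OneLoopSplit β) {γ₀ κ θ r m : ℝ} {k₁ : ℕ} (hγ₀ : 0 < γ₀) (hall : AllScalesSeq S.β0 κ θ)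
    (hlist : ∀ k, k ≤ k₁ → m ≤ S.β0 k) (hrem : RemainderConst S γ₀ r) (hr : r < m - κ * θ ^ k₁)
    (hcont : BetaContH γ₀ β) : B12.Thm2Printed C L :=
  thm2Printed_of_allScalesConst hgen hL S hγ₀ hall hlist hrem hr hcont (betaUpperH_of_allScales_const S hall hrem)

/-- (0.31) with the upper constant on the fine lattices, (U) DERIVED (`β′ = β⁰_1 + κ + r`). [cite: Balaban1987RG1, Thm 2 (0.31) p.259] -/
theorem thm2_fineLattices_of_allScalesConst_cont {C : B12.Construction} (hgen : ForwardGenerated C β)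
    (S : B12Beta.OneLoopSplit β) {γ₀ κ θ r m : ℝ} {k₁ : ℕ} (hγ₀ : 0 < γ₀) (hall : AllScalesSeq S.β0 κ θ)
    (hlist : ∀ k, k ≤ k₁ → m ≤ S.β0 k) (hrem : RemainderConst S γ₀ r) (hr : r < m - κ * θ ^ k₁)
    (hcont : BetaContH γ₀ β) :
    ∀ (n : ℕ) (γ : ℝ), 0 < γ → γ ≤ γ₀ → ∀ g : ℝ, 0 < g → g ≤ γ → ∀ K : ℕ,
      ∃ g0 : ℝ, (C ⟨K, n, g0⟩).flow.InInterval γ K ∧ (C ⟨K, n, g0⟩).flow.g K = g ∧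
        Step.Discrete031 ((m - κ * θ ^ k₁ - r) / 2) (S.β0 0 + κ + r) K g (C ⟨K, n, g0⟩).flow.g :=
  thm2_fineLattices_of_allScalesConst hgen S hγ₀ hall hlist hrem hr (betaUpperH_of_allScales_const S hall hrem) hcont

/-! ## 3. Chain level: the remainder slot filled by the printed chain (`ChainL`, `ChainT`; wall item (D4) as fields) -/

/-- The one condition is a satisfiable NUMERIC restriction on ε₁ once the gap holds: for `κθ^{k₁} < m` and any
coefficient `K` there is `ε₁ > 0` with `ε₁·K < m − κθ^{k₁}` (printed type "ε₁ sufficiently small", [II] p. 21; whether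
the inductive construction runs at that ε₁ is the content of the leaves). [cite: Balaban1988RG2Cluster, p.21 (before (2.40))] -/
theorem exists_eps1_lt_allScales {κ θ m : ℝ} {k₁ : ℕ} (K : ℝ) (hgap : κ * θ ^ k₁ < m) :
    ∃ ε₁ : ℝ, 0 < ε₁ ∧ ε₁ * K < m - κ * θ ^ k₁ :=
  exists_eps1_lt _ K (sub_pos.mpr hgap)

/-- **THEOREM 2 AS PRINTED, ALL-SCALES × CONSTANT, THE REMAINDER SLOT FILLED BY A WINDOW CHAIN** `R : ChainL d M μ ν S γ₀ c ℓ
α₂ B₃` under `CondsL`, `R22gen`, the printed signs and the ONE condition `ε₁·K_rem,L < m − κθ^{k₁}` —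
`ChainL.abs_beta1_le` ∘ `thm2Printed_of_allScalesConst`.  Binders and their status: `hgen` MODELLING; `hL` printed; `hall`
asym (LOCATED-UNPRINTED in all-scales form, O-asym1-1); `hlist` cap (COMPUTATIONAL LEAVES, lower values only);
`R, hC, h22, hs, hd, hM` an4 ∕ asym2 (printed leaves as fields, k-free closed-form thresholds); `hε₁` printed-TYPE
restriction; `hcont` (C) (D5); `hup` (U).  NOT Theorem 2 unconditionally.
[cite: Balaban1987RG1, Thm 2 p.259 with (0.31); Balaban1988RG2Cluster, (2.38) p.20 and p.21] -/
theorem thm2Printed_of_allScalesChainL {C : B12.Construction} (hgen : ForwardGenerated C β) {L : ℝ} (hL : 1 < L)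
    (S : B12Beta.OneLoopSplit β) {M : ℕ} {μ ν : Fin d} {γ₀ : ℝ} {c : B13.Consts} {ℓ α₂ B₃ : ℝ}
    (R : ChainL d M μ ν S γ₀ c ℓ α₂ B₃) (hC : CondsL d c ℓ) (h22 : c.R22gen ℓ) (hs : SignsL c α₂ B₃) (hd : 0 < d)
    (hM : 0 < M) {κ θ β' m : ℝ} {k₁ : ℕ} (hγ₀ : 0 < γ₀) (hall : AllScalesSeq S.β0 κ θ)
    (hlist : ∀ k, k ≤ k₁ → m ≤ S.β0 k) (hε₁ : c.ε₁ * remCoeffL d M c α₂ B₃ < m - κ * θ ^ k₁)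
    (hcont : BetaContH γ₀ β) (hup : BetaUpperH β' γ₀ β) : B12.Thm2Printed C L :=
  thm2Printed_of_allScalesConst hgen hL S hγ₀ hall hlist (R.abs_beta1_le hC h22 hs hd hM) hε₁ hcont hup

/-- … torus chain `ChainT` (periodic carrier of print; same `K_rem,L`). [cite: Balaban1987RG1, Thm 2 p.259 with (0.31); Balaban1988RG2Cluster, (2.38) p.20 and p.21] -/
theorem thm2Printed_of_allScalesChainT {C : B12.Construction} (hgen : ForwardGenerated C β) {L : ℝ} (hL : 1 < L)
    (S : B12Beta.OneLoopSplit β) {M : ℕ} [NeZero M] {μ ν : Fin d} {γ₀ : ℝ} {c : B13.Consts} {ℓ α₂ B₃ : ℝ}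
    (R : ChainT d M μ ν S γ₀ c ℓ α₂ B₃) (hC : CondsL d c ℓ) (h22 : c.R22gen ℓ) (hs : SignsL c α₂ B₃) (hd : 0 < d)
    {κ θ β' m : ℝ} {k₁ : ℕ} (hγ₀ : 0 < γ₀) (hall : AllScalesSeq S.β0 κ θ) (hlist : ∀ k, k ≤ k₁ → m ≤ S.β0 k)
    (hε₁ : c.ε₁ * remCoeffL d M c α₂ B₃ < m - κ * θ ^ k₁) (hcont : BetaContH γ₀ β) (hup : BetaUpperH β' γ₀ β) :
    B12.Thm2Printed C L :=
  thm2Printed_of_allScalesConst hgen hL S hγ₀ hall hlist (R.abs_beta1_le hC h22 hs hd) hε₁ hcont hup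

/-- … window chain with the ELEMENTARY closed-form coefficient `E = RemainderConstNumerals.elemCoeffL d M c α₂ B₃`.
[cite: Balaban1987RG1, Thm 2 p.259 with (0.31); Balaban1988RG2Cluster, (2.38) p.20 and p.21] -/
theorem thm2Printed_of_allScalesChainL_elem {C : B12.Construction} (hgen : ForwardGenerated C β) {L : ℝ} (hL : 1 < L)
    (S : B12Beta.OneLoopSplit β) {M : ℕ} {μ ν : Fin d} {γ₀ : ℝ} {c : B13.Consts} {ℓ α₂ B₃ : ℝ}
    (R : ChainL d M μ ν S γ₀ c ℓ α₂ B₃) (hC : CondsL d c ℓ) (h22 : c.R22gen ℓ) (hs : SignsL c α₂ B₃) (hd : 0 < d)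
    (hM : 0 < M) {κ θ β' m : ℝ} {k₁ : ℕ} (hγ₀ : 0 < γ₀) (hall : AllScalesSeq S.β0 κ θ)
    (hlist : ∀ k, k ≤ k₁ → m ≤ S.β0 k) (hε₁ : c.ε₁ * elemCoeffL d M c α₂ B₃ < m - κ * θ ^ k₁)
    (hcont : BetaContH γ₀ β) (hup : BetaUpperH β' γ₀ β) : B12.Thm2Printed C L :=
  thm2Printed_of_allScalesConst hgen hL S hγ₀ hall hlist
    (RemainderConstNumerals.ChainL.abs_beta1_le_elem R hC h22 hs hd hM) hε₁ hcont hup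

/-- **The END statement `EndpointExistence C`, all-scales × constant, window chain.**
[cite: Balaban1987RG1, Thm 2 p.259 (first sentence); Balaban1988RG2Cluster, (2.38) p.20 and p.21] -/
theorem endpointExistence_of_allScalesChainL {C : B12.Construction} (hgen : ForwardGenerated C β)
    (S : B12Beta.OneLoopSplit β) {M : ℕ} {μ ν : Fin d} {γ₀ : ℝ} {c : B13.Consts} {ℓ α₂ B₃ : ℝ}
    (R : ChainL d M μ ν S γ₀ c ℓ α₂ B₃) (hC : CondsL d c ℓ) (h22 : c.R22gen ℓ) (hs : SignsL c α₂ B₃) (hd : 0 < d)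
    (hM : 0 < M) {κ θ β' m : ℝ} {k₁ : ℕ} (hγ₀ : 0 < γ₀) (hall : AllScalesSeq S.β0 κ θ)
    (hlist : ∀ k, k ≤ k₁ → m ≤ S.β0 k) (hε₁ : c.ε₁ * remCoeffL d M c α₂ B₃ < m - κ * θ ^ k₁)
    (hup : BetaUpperH β' γ₀ β) (hcont : BetaContH γ₀ β) : EndpointExistence C :=
  endpointExistence_of_allScalesConst hgen S hγ₀ hall hlist (R.abs_beta1_le hC h22 hs hd hM) hε₁ hup hcont

/-- **Theorem 2 as printed from the three lanes on the all-scales road, window chain, (U) DERIVED** — no `hup`.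
[cite: Balaban1987RG1, Thm 2 p.259 with (0.31); Balaban1988RG2Cluster, (2.38) p.20 and p.21] -/
theorem thm2Printed_of_allScalesChainL_cont {C : B12.Construction} (hgen : ForwardGenerated C β) {L : ℝ} (hL : 1 < L)
    (S : B12Beta.OneLoopSplit β) {M : ℕ} {μ ν : Fin d} {γ₀ : ℝ} {c : B13.Consts} {ℓ α₂ B₃ : ℝ}
    (R : ChainL d M μ ν S γ₀ c ℓ α₂ B₃) (hC : CondsL d c ℓ) (h22 : c.R22gen ℓ) (hs : SignsL c α₂ B₃) (hd : 0 < d)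
    (hM : 0 < M) {κ θ m : ℝ} {k₁ : ℕ} (hγ₀ : 0 < γ₀) (hall : AllScalesSeq S.β0 κ θ)
    (hlist : ∀ k, k ≤ k₁ → m ≤ S.β0 k) (hε₁ : c.ε₁ * remCoeffL d M c α₂ B₃ < m - κ * θ ^ k₁)
    (hcont : BetaContH γ₀ β) : B12.Thm2Printed C L :=
  thm2Printed_of_allScalesConst_cont hgen hL S hγ₀ hall hlist (R.abs_beta1_le hC h22 hs hd hM) hε₁ hcont

/-- **END from the three lanes on the all-scales road, window chain, (U) DERIVED** — no `hup`.
[cite: Balaban1987RG1, Thm 2 p.259 (first sentence); Balaban1988RG2Cluster, (2.38) p.20 and p.21] -/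
theorem endpointExistence_of_allScalesChainL_cont {C : B12.Construction} (hgen : ForwardGenerated C β)
    (S : B12Beta.OneLoopSplit β) {M : ℕ} {μ ν : Fin d} {γ₀ : ℝ} {c : B13.Consts} {ℓ α₂ B₃ : ℝ}
    (R : ChainL d M μ ν S γ₀ c ℓ α₂ B₃) (hC : CondsL d c ℓ) (h22 : c.R22gen ℓ) (hs : SignsL c α₂ B₃) (hd : 0 < d)
    (hM : 0 < M) {κ θ m : ℝ} {k₁ : ℕ} (hγ₀ : 0 < γ₀) (hall : AllScalesSeq S.β0 κ θ)
    (hlist : ∀ k, k ≤ k₁ → m ≤ S.β0 k) (hε₁ : c.ε₁ * remCoeffL d M c α₂ B₃ < m - κ * θ ^ k₁)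
    (hcont : BetaContH γ₀ β) : EndpointExistence C :=
  endpointExistence_of_allScalesConst_cont hgen S hγ₀ hall hlist (R.abs_beta1_le hC h22 hs hd hM) hε₁ hcont

/-! ## 4. From the tree's rate currencies: the sharper Cauchy road; RCC §7 recovered (consistency) -/

/-- **(AF-0) on all boxes from the ONE-STEP Cauchy rate, SHARPER FLOOR**: `CauchyRate S.β0 c θ` (`0 ≤ θ < 1`), the one-sided
list and the constant remainder give `β_{k+1} ≥ m − (c/(1 − θ))θ^{k₁} − r` — RCC §7's Cauchy twin has
`m − (c/(1 − θ))θ^{k₁}(1 + θ) − r`; the constructed limit never appears. [cite: Balaban1987RG1, (2.12)–(2.14) p.268] -/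
theorem betaLowerH_of_cauchyAllScalesConst (S : B12Beta.OneLoopSplit β) {γ₀ c θ r m : ℝ} {k₁ : ℕ} (hθ0 : 0 ≤ θ)
    (hθ1 : θ < 1) (hrate : CauchyRate S.β0 c θ) (hlist : ∀ k, k ≤ k₁ → m ≤ S.β0 k) (hrem : RemainderConst S γ₀ r) :
    BetaLowerH (m - c / (1 - θ) * θ ^ k₁ - r) γ₀ β :=
  betaLowerH_of_allScalesConst S (allScalesSeq_of_cauchyRate hrate hθ0 hθ1) hlist hrem

/-- **THEOREM 2 AS PRINTED from the CAUCHY shape, SHARPER CONDITION** `r < m − (c/(1 − θ))θ^{k₁}` (vs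
`RemainderConstCertified.thm2Printed_of_cauchyMarginConst`: `r < m − (c/(1 − θ))θ^{k₁}(1 + θ)`; same binders otherwise).
[cite: Balaban1987RG1, Thm 2 p.259 with (0.31)] -/
theorem thm2Printed_of_cauchyAllScalesConst {C : B12.Construction} (hgen : ForwardGenerated C β) {L : ℝ} (hL : 1 < L)
    (S : B12Beta.OneLoopSplit β) {γ₀ c θ r β' m : ℝ} {k₁ : ℕ} (hγ₀ : 0 < γ₀) (hθ0 : 0 ≤ θ) (hθ1 : θ < 1)
    (hrate : CauchyRate S.β0 c θ) (hlist : ∀ k, k ≤ k₁ → m ≤ S.β0 k) (hrem : RemainderConst S γ₀ r)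
    (hr : r < m - c / (1 - θ) * θ ^ k₁) (hcont : BetaContH γ₀ β) (hup : BetaUpperH β' γ₀ β) :
    B12.Thm2Printed C L :=
  thm2Printed_of_allScalesConst hgen hL S hγ₀ (allScalesSeq_of_cauchyRate hrate hθ0 hθ1) hlist hrem hr hcont hup

/-- … (U) DERIVED (`β′ = β⁰_1 + c/(1 − θ) + r`), no `hup`. [cite: Balaban1987RG1, Thm 2 p.259 with (0.31)] -/
theorem thm2Printed_of_cauchyAllScalesConst_cont {C : B12.Construction} (hgen : ForwardGenerated C β) {L : ℝ}
    (hL : 1 < L) (S : B12Beta.OneLoopSplit β) {γ₀ c θ r m : ℝ} {k₁ : ℕ} (hγ₀ : 0 < γ₀) (hθ0 : 0 ≤ θ)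
    (hθ1 : θ < 1) (hrate : CauchyRate S.β0 c θ) (hlist : ∀ k, k ≤ k₁ → m ≤ S.β0 k) (hrem : RemainderConst S γ₀ r)
    (hr : r < m - c / (1 - θ) * θ ^ k₁) (hcont : BetaContH γ₀ β) : B12.Thm2Printed C L :=
  thm2Printed_of_allScalesConst_cont hgen hL S hγ₀ (allScalesSeq_of_cauchyRate hrate hθ0 hθ1) hlist hrem hr hcont

/-- CONSISTENCY (kernel-checked, no new declaration): RCC §7's floor `m − c₀θ^{k₁}(1 + θ) − r` IS the all-scales floor at
`κ = c₀(1 + θ)` (`allScalesSeq_of_geomRate` ∘ `betaLowerH_of_allScalesConst`) — the statement of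
`RemainderConstCertified.betaLowerH_of_marginConst`, re-derived. [folklore] -/
example (S : B12Beta.OneLoopSplit β) {γ₀ binf c₀ θ r m : ℝ} {k₁ : ℕ} (hθ0 : 0 ≤ θ) (hθ1 : θ ≤ 1)
    (hconv : GeomRate S.β0 binf c₀ θ) (hlist : ∀ k, k ≤ k₁ → m ≤ S.β0 k) (hrem : RemainderConst S γ₀ r) :
    BetaLowerH (m - c₀ * θ ^ k₁ * (1 + θ) - r) γ₀ β := by
  have e : m - c₀ * θ ^ k₁ * (1 + θ) - r = m - c₀ * (1 + θ) * θ ^ k₁ - r := by ring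
  rw [e]
  exact betaLowerH_of_allScalesConst S (allScalesSeq_of_geomRate hconv hθ0 hθ1) hlist hrem

/-- CONSISTENCY: RCC §7's `thm2Printed_of_marginConst` re-derived through the all-scales road (same binders, same
condition `r < m − c₀θ^{k₁}(1 + θ)`). [cite: Balaban1987RG1, Thm 2 p.259 with (0.31)] -/
example {C : B12.Construction} (hgen : ForwardGenerated C β) {L : ℝ} (hL : 1 < L) (S : B12Beta.OneLoopSplit β)
    {γ₀ binf c₀ θ r β' m : ℝ} {k₁ : ℕ} (hγ₀ : 0 < γ₀) (hθ0 : 0 ≤ θ) (hθ1 : θ ≤ 1) (hconv : GeomRate S.β0 binf c₀ θ)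
    (hlist : ∀ k, k ≤ k₁ → m ≤ S.β0 k) (hrem : RemainderConst S γ₀ r) (hr : r < m - c₀ * θ ^ k₁ * (1 + θ))
    (hcont : BetaContH γ₀ β) (hup : BetaUpperH β' γ₀ β) : B12.Thm2Printed C L :=
  thm2Printed_of_allScalesConst hgen hL S hγ₀ (allScalesSeq_of_geomRate hconv hθ0 hθ1) hlist hrem
    (by have e : c₀ * (1 + θ) * θ ^ k₁ = c₀ * θ ^ k₁ * (1 + θ) := by ring
        rw [e]; exact hr) hcont hup

/-! ## 5. Kernel side: (UD) + `HessKerSchurCauchy.AllScalesRate` ⟹ `AllScalesSeq` of the second moments (no θ-range,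
no limit kernel), the `hessKer` ENDs in scalar all-scales form, and the joined END -/

section Kernel

variable {D : ℕ}

/-- **ALL-SCALES KERNEL BOUND ⟹ ALL-SCALES BOUND OF THE SECOND MOMENTS**, `κ = β′(C′, δ′) = betaPrime510 D C′ δ′`:
`|β⁰_{k+j+1} − β⁰_{k+1}| ≤ C′θ^k Σ_x |x|₁² e^{−δ′|x|₁}` — dominated summation of (1.22) against the all-scales majorant
(`B12Sec2to5.secondMoment_abs_le_of_decay510` on the difference kernel, `LimitRate.secondMoment_subKernel`); every second
moment assumed absolutely convergent.  NO range of `θ`, NO limit kernel. [cite: Balaban1987RG1, (1.22) p.264 and (5.10) p.293] -/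
theorem allScalesSeq_secondMoment_of_summable {P : ℕ → B12Beta.Kernel D} {μ ν : Fin D} {C' δ' θ : ℝ}
    (hP : ∀ k, Summable fun x : Fin D → ℤ => P k μ ν x * (x μ : ℝ) * (x ν : ℝ))
    (hA : AllScalesRate P μ ν C' δ' θ) (hδ' : 0 < δ') :
    AllScalesSeq (fun k => B12Beta.secondMoment (P k) μ ν) (betaPrime510 D C' δ') θ := fun k j => by
  have hD := secondMoment_abs_le_of_decay510 (P := subKernel (P (k + j)) (P k)) hδ' (hA k j)
  show |B12Beta.secondMoment (P (k + j)) μ ν - B12Beta.secondMoment (P k) μ ν| ≤ betaPrime510 D C' δ' * θ ^ k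
  rw [← secondMoment_subKernel (P (k + j)) (P k) μ ν (hP (k + j)) (hP k)]
  calc |B12Beta.secondMoment (subKernel (P (k + j)) (P k)) μ ν|
        ≤ C' * θ ^ k * ∑' x : Fin D → ℤ, l1 x ^ 2 * Real.exp (-δ' * l1 x) := hD.2
    _ = betaPrime510 D C' δ' * θ ^ k := by unfold betaPrime510; ring

/-- **(UD) + ALL-SCALES ⟹ `AllScalesSeq (k ↦ β⁰_{k+1}) (betaPrime510 D C′ δ′) θ`** (summability from (UD), `δ > 0`;
`δ′ > 0`); NO `0 ≤ θ`, NO `θ < 1`, NO `limKernelOf` — compare `HessKerSchurCauchy.AllScalesRate.geomRate_secondMoment`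
(same `c₀`, but `0 ≤ θ < 1` and the telescoped limit in the conclusion). [cite: Balaban1987RG1, (1.22) p.264 and (5.10) p.293] -/
theorem allScalesSeq_secondMoment {P : ℕ → B12Beta.Kernel D} {μ ν : Fin D} {C δ C' δ' θ : ℝ}
    (hU : LimitRate.UniformDecay P μ ν C δ) (hA : AllScalesRate P μ ν C' δ' θ) (hδ : 0 < δ) (hδ' : 0 < δ') :
    AllScalesSeq (fun k => B12Beta.secondMoment (P k) μ ν) (betaPrime510 D C' δ') θ :=
  allScalesSeq_secondMoment_of_summable (fun k => hU.summable hδ k) hA hδ'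

end Kernel

section HalfV

variable {D : ℕ} {F : Type*} [Fintype F]
variable {A : ℕ → MKer D F} {V : ℕ → Fin D → (Fin D → ℤ) → MKer D F}
  {W : ℕ → Fin D → (Fin D → ℤ) → Fin D → (Fin D → ℤ) → MKer D F} {R BA BV BW cA cV cW θ : ℝ} {N : ℕ}

/-- **SCALAR ALL-SCALES END for `k ↦ hessKer (A k) (V k) (W k)` from all-scales data in the weighted classes** — THE TREE'S
constant `betaPrime510 D (lipW B_A B_A B_V B_V B_W c_A c_V c_W) (R·N)` (`HessKerSchur.geomRate_secondMoment_hessKer_W` ∕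
`HessKerSchurCauchy.geomRate_secondMoment_hessKer_halfV_allScales`), now with NO `0 ≤ θ < 1` among the binders and NO
limit object even in the conclusion (`uniformDecay_hessKer_halfV` + `allScalesRate_hessKer_halfV` ∘
`allScalesSeq_secondMoment`). [folklore] -/
theorem allScalesSeq_secondMoment_hessKer_halfV (hA : ∀ k, ColW (A k) R BA)
    (hAall : ∀ k j, ColW (A (k + j) - A k) R (cA * θ ^ k))
    (hV : ∀ k, VertexFamilyW (V k) N (R / 2) BV) (hVall : ∀ k j, VertexFamilyW (V (k + j) - V k) N (R / 2) (cV * θ ^ k))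
    (hW : ∀ k, VertexFamily₂W (W k) N R BW) (hWall : ∀ k j, VertexFamily₂W (W (k + j) - W k) N R (cW * θ ^ k)) (hR : 0 < R)
    (hN : 1 ≤ N) (μ ν : Fin D) :
    AllScalesSeq (fun k => B12Beta.secondMoment (hessKer (A k) (V k) (W k)) μ ν)
      (betaPrime510 D (lipW BA BA BV BV BW cA cV cW) (R * N)) θ := by
  have hRN : 0 < R * (N : ℝ) := mul_pos hR (by exact_mod_cast (show 0 < N by omega))
  exact allScalesSeq_secondMoment (uniformDecay_hessKer_halfV hA hV hW hR.le μ ν)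
    (allScalesRate_hessKer_halfV hA hAall hV hVall hW hWall hR μ ν) hRN hRN

end HalfV

section Primitives

variable {d : ℕ}
variable {K : ℕ → MKer (d + 1) (Fib d)} {S : ℕ → Fin (d + 1) → (Fin (d + 1) → ℤ) → MKer (d + 1) (Fib d)}
  {W : ℕ → Fin (d + 1) → (Fin (d + 1) → ℤ) → Fin (d + 1) → (Fin (d + 1) → ℤ) → MKer (d + 1) (Fib d)}
  {R BK cK Bs cS BW cW θ : ℝ} {N : ℕ}

/-- **SCALAR ALL-SCALES END FROM THE PRIMITIVES `(K_k, S_k, W_k)`** (the `TstepOf` shape `hessKer K (vertexOfK K N S) W`):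
THE TREE'S constant `betaPrime510 (d+1) (lipW B_K B_K (B_K B_s) (B_K B_s) B_W c_K (c_K B_s + B_K c_S) c_W) (R·N)`, no
θ-range, no limit. [folklore] -/
theorem allScalesSeq_secondMoment_hessKer_primitivesW (hK : ∀ k, ColW (K k) R BK)
    (hKall : ∀ k j, ColW (K (k + j) - K k) R (cK * θ ^ k))
    (hS : ∀ k, LocStencilW (S k) (R / 2) Bs) (hSall : ∀ k j, LocStencilW (S (k + j) - S k) (R / 2) (cS * θ ^ k))
    (hW : ∀ k, VertexFamily₂W (W k) N R BW) (hWall : ∀ k j, VertexFamily₂W (W (k + j) - W k) N R (cW * θ ^ k)) (hR : 0 < R)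
    (hN : 1 ≤ N) (μ ν : Fin (d + 1)) :
    AllScalesSeq (fun k => B12Beta.secondMoment (hessKer (K k) (vertexOfK (K k) N (S k)) (W k)) μ ν)
      (betaPrime510 (d + 1) (lipW BK BK (BK * Bs) (BK * Bs) BW cK (cK * Bs + BK * cS) cW) (R * N)) θ :=
  allScalesSeq_secondMoment_hessKer_halfV (V := fun k => vertexOfK (K k) N (S k)) hK hKall
    (fun k => vertexFamilyW_vertexOfK (hK k) (hS k) hR N) (fun k j => vertexFamilyW_vertexOfK_allScales hK hKall hS hSall hR N k j)
    hW hWall hR hN μ ν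

end Primitives

section Operators

variable {d : ℕ}
variable {G H : ℕ → MKer (d + 1) (Fib d)} {S : ℕ → Fin (d + 1) → (Fin (d + 1) → ℤ) → MKer (d + 1) (Fib d)}
  {W : ℕ → Fin (d + 1) → (Fin (d + 1) → ℤ) → Fin (d + 1) → (Fin (d + 1) → ℤ) → MKer (d + 1) (Fib d)}
  {R BG BH cH Bs cS BW cW θ : ℝ} {N : ℕ}

/-- **SCALAR ALL-SCALES END FROM THE FINITE-LEVEL OPERATORS** (two-sided inverses `comp (G k) (H k) = idK`,
`comp (H k) (G k) = idK` at every level, all-scales operator ∕ stencil ∕ vertex deviations; `HessKerSchurCauchy.colW_resolvent_allScales`):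
THE TREE'S constant with `c_K := B_G c_H B_G`, no θ-range, no limit operator, no limit kernel. [folklore] -/
theorem allScalesSeq_secondMoment_hessKer_operatorsW (hR : 0 < R) (hG : ∀ k, ColW (G k) R BG) (hH : ∀ k, ColW (H k) R BH)
    (hinvL : ∀ k, comp (G k) (H k) = idK) (hinvR : ∀ k, comp (H k) (G k) = idK)
    (hHall : ∀ k j, ColW (H (k + j) - H k) R (cH * θ ^ k))
    (hS : ∀ k, LocStencilW (S k) (R / 2) Bs) (hSall : ∀ k j, LocStencilW (S (k + j) - S k) (R / 2) (cS * θ ^ k))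
    (hW : ∀ k, VertexFamily₂W (W k) N R BW) (hWall : ∀ k j, VertexFamily₂W (W (k + j) - W k) N R (cW * θ ^ k))
    (hN : 1 ≤ N) (μ ν : Fin (d + 1)) :
    AllScalesSeq (fun k => B12Beta.secondMoment (hessKer (G k) (vertexOfK (G k) N (S k)) (W k)) μ ν)
      (betaPrime510 (d + 1)
        (lipW BG BG (BG * Bs) (BG * Bs) BW (BG * cH * BG) (BG * cH * BG * Bs + BG * cS) cW) (R * N)) θ :=
  allScalesSeq_secondMoment_hessKer_primitivesW hG (colW_resolvent_allScales hR hG hH hinvL hinvR hHall) hS hSall hW hWall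
    hR hN μ ν

end Operators

section Pointwise

variable {d : ℕ}
variable {K : ℕ → MKer (d + 1) (Fib d)} {S : ℕ → Fin (d + 1) → (Fin (d + 1) → ℤ) → MKer (d + 1) (Fib d)}
  {W : ℕ → Fin (d + 1) → (Fin (d + 1) → ℤ) → Fin (d + 1) → (Fin (d + 1) → ℤ) → MKer (d + 1) (Fib d)}
  {R C cK δK Cs cS δS Cw cW δW θ : ℝ} {N : ℕ}

/-- **SCALAR ALL-SCALES END FROM POINTWISE (`Decays`-form) ALL-SCALES DATA ON THE PRIMITIVES**, at any target rate
`0 < R < δK`, `R/2 < δS`, `R < δW`: the tree's `_of_pointwise` constant (the 9-slot `Zl` list of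
`HessKerSchur.geomRate_secondMoment_hessKer_W_of_pointwise` ∕ `HessKerSchurCauchy.…_of_pointwise_allScales`), no θ-range,
no limit. [folklore] -/
theorem allScalesSeq_secondMoment_hessKer_primitivesW_of_pointwise
    (hK : ∀ k, Decays (K k) C δK) (hKall : ∀ k j, Decays (K (k + j) - K k) (cK * θ ^ k) δK)
    (hS : ∀ k, LocStencil (S k) Cs δS) (hSall : ∀ k j, LocStencil (S (k + j) - S k) (cS * θ ^ k) δS)
    (hW : ∀ k, VertexFamily₂ (W k) N Cw δW) (hWall : ∀ k j, VertexFamily₂ (W (k + j) - W k) N (cW * θ ^ k) δW)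
    (hR : 0 < R) (hRK : R < δK) (hRS : R / 2 < δS) (hRW : R < δW) (hN : 1 ≤ N) (μ ν : Fin (d + 1)) :
    AllScalesSeq (fun k => B12Beta.secondMoment (hessKer (K k) (vertexOfK (K k) N (S k)) (W k)) μ ν)
      (betaPrime510 (d + 1)
        (lipW ((Fintype.card (Fib d) : ℝ) * C * Zl (d + 1) (δK - R)) ((Fintype.card (Fib d) : ℝ) * C * Zl (d + 1) (δK - R))
          ((Fintype.card (Fib d) : ℝ) * C * Zl (d + 1) (δK - R) * ((Fintype.card (Fib d) : ℝ) ^ 2 * Cs * Zl (d + 1) (δS - R / 2) ^ 2))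
          ((Fintype.card (Fib d) : ℝ) * C * Zl (d + 1) (δK - R) * ((Fintype.card (Fib d) : ℝ) ^ 2 * Cs * Zl (d + 1) (δS - R / 2) ^ 2))
          ((Fintype.card (Fib d) : ℝ) ^ 2 * Cw * Zl (d + 1) (δW - R) ^ 2)
          ((Fintype.card (Fib d) : ℝ) * cK * Zl (d + 1) (δK - R))
          ((Fintype.card (Fib d) : ℝ) * cK * Zl (d + 1) (δK - R) * ((Fintype.card (Fib d) : ℝ) ^ 2 * Cs * Zl (d + 1) (δS - R / 2) ^ 2) +
            (Fintype.card (Fib d) : ℝ) * C * Zl (d + 1) (δK - R) * ((Fintype.card (Fib d) : ℝ) ^ 2 * cS * Zl (d + 1) (δS - R / 2) ^ 2))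
          ((Fintype.card (Fib d) : ℝ) ^ 2 * cW * Zl (d + 1) (δW - R) ^ 2))
        (R * N)) θ := by
  have hθK : ∀ k j, ColW (K (k + j) - K k) R ((Fintype.card (Fib d) : ℝ) * cK * Zl (d + 1) (δK - R) * θ ^ k) := fun k j =>
    (colW_of_decays (hKall k j) hRK).mono (le_of_eq (by ring))
  have hθS : ∀ k j, LocStencilW (S (k + j) - S k) (R / 2)
      ((Fintype.card (Fib d) : ℝ) ^ 2 * cS * Zl (d + 1) (δS - R / 2) ^ 2 * θ ^ k) := fun k j =>
    (locStencilW_of_locStencil (hSall k j) hRS).mono (le_of_eq (by ring))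
  have hθW : ∀ k j, VertexFamily₂W (W (k + j) - W k) N R ((Fintype.card (Fib d) : ℝ) ^ 2 * cW * Zl (d + 1) (δW - R) ^ 2 * θ ^ k) :=
    fun k j => (vertexFamily₂W_of_vertexFamily₂ (hWall k j) hRW).mono (le_of_eq (by ring))
  exact allScalesSeq_secondMoment_hessKer_primitivesW (fun k => colW_of_decays (hK k) hRK) hθK
    (fun k => locStencilW_of_locStencil (hS k) hRS) hθS (fun k => vertexFamily₂W_of_vertexFamily₂ (hW k) hRW) hθW hR hN μ ν

end Pointwise

section JoinedEnd

variable {D : ℕ}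

/-- **THEOREM 2 AS PRINTED from (UD) + the ALL-SCALES KERNEL BOUND** under the identification `S.β0 k = secondMoment (P k) μ ν`
((1.22) at zero couplings): binders DAG, `1 < L`, `S`, `hβ0`, (UD) `hU` (`δ > 0`), `AllScalesRate P μ ν C′ δ′ θ` (`δ′ > 0`) —
NO range of `θ`, NO limit kernel —, the one-sided certified list, `RemainderConst S γ₀ r`, the ONE condition
`r < m − betaPrime510 D C′ δ′ · θ^{k₁}`, (C), (U). [cite: Balaban1987RG1, (1.22) p.264 and Thm 2 p.259 with (0.31)] -/
theorem thm2Printed_of_allScalesRateConst {C : B12.Construction} (hgen : ForwardGenerated C β) {L : ℝ} (hL : 1 < L)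
    (S : B12Beta.OneLoopSplit β) {P : ℕ → B12Beta.Kernel D} {μ ν : Fin D} {Cu δ C' δ' θ : ℝ}
    (hβ0 : ∀ k, S.β0 k = B12Beta.secondMoment (P k) μ ν) (hU : LimitRate.UniformDecay P μ ν Cu δ) (hA : AllScalesRate P μ ν C' δ' θ)
    (hδ : 0 < δ) (hδ' : 0 < δ') {γ₀ r β' m : ℝ} {k₁ : ℕ} (hγ₀ : 0 < γ₀) (hlist : ∀ k, k ≤ k₁ → m ≤ S.β0 k)
    (hrem : RemainderConst S γ₀ r) (hr : r < m - betaPrime510 D C' δ' * θ ^ k₁) (hcont : BetaContH γ₀ β)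
    (hup : BetaUpperH β' γ₀ β) : B12.Thm2Printed C L :=
  thm2Printed_of_allScalesConst hgen hL S hγ₀ ((allScalesSeq_secondMoment hU hA hδ hδ').congr hβ0) hlist hrem hr hcont hup

/-- … (U) DERIVED (`β′ = β⁰_1 + betaPrime510 D C′ δ′ + r`), no `hup`. [cite: Balaban1987RG1, (1.22) p.264 and Thm 2 p.259 with (0.31)] -/
theorem thm2Printed_of_allScalesRateConst_cont {C : B12.Construction} (hgen : ForwardGenerated C β) {L : ℝ} (hL : 1 < L)
    (S : B12Beta.OneLoopSplit β) {P : ℕ → B12Beta.Kernel D} {μ ν : Fin D} {Cu δ C' δ' θ : ℝ}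
    (hβ0 : ∀ k, S.β0 k = B12Beta.secondMoment (P k) μ ν) (hU : LimitRate.UniformDecay P μ ν Cu δ) (hA : AllScalesRate P μ ν C' δ' θ)
    (hδ : 0 < δ) (hδ' : 0 < δ') {γ₀ r m : ℝ} {k₁ : ℕ} (hγ₀ : 0 < γ₀) (hlist : ∀ k, k ≤ k₁ → m ≤ S.β0 k)
    (hrem : RemainderConst S γ₀ r) (hr : r < m - betaPrime510 D C' δ' * θ ^ k₁) (hcont : BetaContH γ₀ β) :
    B12.Thm2Printed C L :=
  thm2Printed_of_allScalesConst_cont hgen hL S hγ₀ ((allScalesSeq_secondMoment hU hA hδ hδ').congr hβ0) hlist hrem hr hcont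

/-- **END `EndpointExistence C` from (UD) + the all-scales kernel bound, (U) DERIVED.** [cite: Balaban1987RG1, (1.22) p.264 and Thm 2 p.259 (first sentence)] -/
theorem endpointExistence_of_allScalesRateConst_cont {C : B12.Construction} (hgen : ForwardGenerated C β)
    (S : B12Beta.OneLoopSplit β) {P : ℕ → B12Beta.Kernel D} {μ ν : Fin D} {Cu δ C' δ' θ : ℝ}
    (hβ0 : ∀ k, S.β0 k = B12Beta.secondMoment (P k) μ ν) (hU : LimitRate.UniformDecay P μ ν Cu δ) (hA : AllScalesRate P μ ν C' δ' θ)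
    (hδ : 0 < δ) (hδ' : 0 < δ') {γ₀ r m : ℝ} {k₁ : ℕ} (hγ₀ : 0 < γ₀) (hlist : ∀ k, k ≤ k₁ → m ≤ S.β0 k)
    (hrem : RemainderConst S γ₀ r) (hr : r < m - betaPrime510 D C' δ' * θ ^ k₁) (hcont : BetaContH γ₀ β) :
    EndpointExistence C :=
  endpointExistence_of_allScalesConst_cont hgen S hγ₀ ((allScalesSeq_secondMoment hU hA hδ hδ').congr hβ0) hlist hrem hr
    hcont

end JoinedEnd

/-! ## 6. Non-vacuity with genuinely scale-dependent one-loop coefficients; the oscillating (non-convergent) split -/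

namespace Witness

open RemainderConstCertified.Witness (geomFamily splitGeom list_splitGeom remainderConst_splitGeom betaUpperH_geomFamily
  eventualFormMarginGeom eventualFormMarginGeom_consts)

/-- On RCC's family `β⁰_{k+1} = 1 + 2^{−k}`: `AllScalesSeq β⁰ 1 (1/2)` (`|2^{−(k+j)} − 2^{−k}| ≤ 2^{−k}`; the constant `1`
is sharp). [folklore] -/
theorem allScalesSeq_splitGeom : AllScalesSeq splitGeom.β0 1 (1 / 2) := fun k j => by
  show |1 + (1 / 2 : ℝ) ^ (k + j) - (1 + (1 / 2 : ℝ) ^ k)| ≤ 1 * (1 / 2) ^ k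
  have h1 : (1 / 2 : ℝ) ^ (k + j) ≤ (1 / 2) ^ k := by
    rw [pow_add]; exact mul_le_of_le_one_right (by positivity) (pow_le_one₀ (by norm_num) (by norm_num))
  have h2 : 0 ≤ (1 / 2 : ℝ) ^ (k + j) := by positivity
  rw [abs_le]; constructor <;> linarith

/-- `eventualFormOfAllScalesConst` instantiated: `γ₀ = 1`, `m = 1` at depths `k ≤ k₁ = 1`, `κ = 1`, `θ = 1/2`, `r = 0`,
`β′ = 2`; the one condition reads `0 < 1 − 1·(1/2) = 1/2`. [folklore] -/
def eventualFormAllScalesGeom : EventualForm geomFamily :=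
  eventualFormOfAllScalesConst splitGeom (γ₀ := 1) (β' := 2) (m := 1) (k₁ := 1) one_pos allScalesSeq_splitGeom
    list_splitGeom remainderConst_splitGeom (by norm_num) betaUpperH_geomFamily (fun _ => continuousOn_const)

/-- Its lower constant is `1/2` and its threshold scale is `0`. [folklore] -/
theorem eventualFormAllScalesGeom_consts : eventualFormAllScalesGeom.b = 1 / 2 ∧ eventualFormAllScalesGeom.k₀ = 0 := by
  refine ⟨?_, rfl⟩
  show (1 : ℝ) - 1 * (1 / 2) ^ 1 - 0 = 1 / 2
  norm_num

/-- **One hop beats two**: on the SAME family, SAME certified depth `k₁ = 1`, SAME data, the margin road's lower constant is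
`1/4` (`RemainderConstCertified.Witness.eventualFormMarginGeom_consts`) and the all-scales road's is `1/2`. [folklore] -/
theorem floors_compared : eventualFormMarginGeom.b < eventualFormAllScalesGeom.b := by
  rw [eventualFormMarginGeom_consts.1, eventualFormAllScalesGeom_consts.1]; norm_num

/-- `BetaAFH geomFamily` re-derived from `betaAFH_of_allScalesConst` (the statement is RCC's landed
`Witness.betaAFH_geomFamily`; kernel-checked consistency, no new declaration). [folklore] -/
example : BetaAFH geomFamily :=
  betaAFH_of_allScalesConst splitGeom (γ₀ := 1) (m := 1) (k₁ := 1) one_pos allScalesSeq_splitGeom list_splitGeom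
    remainderConst_splitGeom (by norm_num)

/-- The (U)-DERIVED upper constant on this family: `β′ = β⁰_1 + κ + r = 2 + 1 + 0`. [folklore] -/
theorem betaUpperH_geomFamily_derived : BetaUpperH (splitGeom.β0 0 + 1 + 0) 1 geomFamily :=
  betaUpperH_of_allScales_const splitGeom allScalesSeq_splitGeom remainderConst_splitGeom

/-- The OSCILLATING family `β_{k+1} ≡ 1 + (−1)^k/4` (no coupling dependence): its one-loop coefficients do NOT converge.
[folklore] -/
def oscFamily : HBeta := fun k _ => 1 + (-1 : ℝ) ^ k / 4

/-- Its split: `β⁰_{k+1} = 1 + (−1)^k/4`, `β¹ ≡ 0`. [folklore] -/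
def splitOsc : B12Beta.OneLoopSplit oscFamily where
  β0 := fun k => 1 + (-1 : ℝ) ^ k / 4
  β1 := fun _ _ => 0
  split := fun _ _ => by simp [oscFamily]
  vanish := fun _ _ _ => rfl

/-- `AllScalesSeq β⁰ (1/2) 1` — the case `θ = 1` (a uniform oscillation budget, no decay). [folklore] -/
theorem allScalesSeq_splitOsc : AllScalesSeq splitOsc.β0 (1 / 2) 1 := fun k j => by
  show |1 + (-1 : ℝ) ^ (k + j) / 4 - (1 + (-1 : ℝ) ^ k / 4)| ≤ 1 / 2 * 1 ^ k
  rw [one_pow, mul_one]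
  have h1 : |(-1 : ℝ) ^ (k + j)| = 1 := by rw [abs_pow, abs_neg, abs_one, one_pow]
  have h2 : |(-1 : ℝ) ^ k| = 1 := by rw [abs_pow, abs_neg, abs_one, one_pow]
  calc |1 + (-1 : ℝ) ^ (k + j) / 4 - (1 + (-1 : ℝ) ^ k / 4)| = |(-1 : ℝ) ^ (k + j) / 4 - (-1 : ℝ) ^ k / 4| := by
        congr 1; ring
    _ ≤ |(-1 : ℝ) ^ (k + j) / 4| + |(-1 : ℝ) ^ k / 4| := abs_sub _ _
    _ = 1 / 2 := by rw [abs_div, abs_div, h1, h2]; norm_num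

/-- The certified list at depth `k₁ = 0`: `5/4 ≤ β⁰_1`. [folklore] -/
theorem list_splitOsc : ∀ k, k ≤ 0 → (5 / 4 : ℝ) ≤ splitOsc.β0 k := fun k hk => by
  rw [Nat.le_zero.mp hk]
  show (5 / 4 : ℝ) ≤ 1 + (-1 : ℝ) ^ 0 / 4
  norm_num

/-- The constant-form remainder bound with `r = 0` on `]0,1]`-boxes. [folklore] -/
theorem remainderConst_splitOsc : RemainderConst splitOsc 1 0 := fun k p _ => by
  show |(0 : ℝ)| ≤ 0
  simp

/-- **`BetaAFH` for a NON-CONVERGENT one-loop sequence** from `betaAFH_of_allScalesConst` (`θ = 1`, `κ = 1/2`, `m = 5/4` at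
`k₁ = 0`, `r = 0`; the one condition `0 < 5/4 − 1/2`; lower constant `3/4`). [folklore] -/
theorem betaAFH_oscFamily : BetaAFH oscFamily :=
  betaAFH_of_allScalesConst splitOsc (γ₀ := 1) (m := 5 / 4) (k₁ := 0) one_pos allScalesSeq_splitOsc list_splitOsc
    remainderConst_splitOsc (by norm_num)

/-- … and the minimal END carrier, with (U) DERIVED (`β′ = β⁰_1 + κ + r = 5/4 + 1/2 + 0`). [folklore] -/
def eventualFormOsc : EventualForm oscFamily :=
  eventualFormOfAllScalesConst splitOsc (γ₀ := 1) (m := 5 / 4) (k₁ := 0) one_pos allScalesSeq_splitOsc list_splitOsc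
    remainderConst_splitOsc (by norm_num) (betaUpperH_of_allScales_const splitOsc allScalesSeq_splitOsc remainderConst_splitOsc)
    (fun _ => continuousOn_const)

/-- Its lower constant is `3/4`, threshold scale `0`. [folklore] -/
theorem eventualFormOsc_consts : eventualFormOsc.b = 3 / 4 ∧ eventualFormOsc.k₀ = 0 := by
  refine ⟨?_, rfl⟩
  show (5 / 4 : ℝ) - 1 / 2 * 1 ^ 0 - 0 = 3 / 4
  norm_num

/-- **No two-ended rate with `0 ≤ θ < 1` holds for the oscillating coefficients** (they would converge; but consecutive
terms stay `1/2` apart) — so NO road of `RateCertificate` ∕ RCC ∕ RCUD applies to `splitOsc`, while §2 does. [folklore] -/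
theorem not_geomRate_splitOsc {binf c₀ θ : ℝ} (hθ0 : 0 ≤ θ) (hθ1 : θ < 1) : ¬ GeomRate splitOsc.β0 binf c₀ θ := by
  intro h
  obtain ⟨K, hK⟩ := (Metric.tendsto_atTop.mp (h.tendsto hθ0 hθ1)) (1 / 4) (by norm_num)
  have h0 := hK K le_rfl
  have h1 := hK (K + 1) (Nat.le_succ K)
  rw [Real.dist_eq] at h0 h1
  have hstep : splitOsc.β0 K - splitOsc.β0 (K + 1) = (-1 : ℝ) ^ K / 2 := by
    show 1 + (-1 : ℝ) ^ K / 4 - (1 + (-1 : ℝ) ^ (K + 1) / 4) = (-1 : ℝ) ^ K / 2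
    rw [pow_succ]; ring
  have habs : |splitOsc.β0 K - splitOsc.β0 (K + 1)| = 1 / 2 := by
    rw [hstep, abs_div, abs_pow, abs_neg, abs_one, one_pow]; norm_num
  have htri := abs_sub_le (splitOsc.β0 K) binf (splitOsc.β0 (K + 1))
  rw [abs_sub_comm binf] at htri
  linarith

/-- … nor a one-step Cauchy rate with `θ < 1`. [folklore] -/
theorem not_cauchyRate_splitOsc {c θ : ℝ} (hθ0 : 0 ≤ θ) (hθ1 : θ < 1) : ¬ CauchyRate splitOsc.β0 c θ := fun h =>
  not_geomRate_splitOsc hθ0 hθ1 (h.geomRate hθ1)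

end Witness

/-! ## 7. (v1.2) The END-grade content of the all-scales hypothesis: a ONE-SIDED TAIL DROP at the certified depth

What the floor `lower_of_list` actually consumes of `AllScalesSeq b κ θ` is its instance at the SINGLE level `k = k₁`, read
ONE-SIDEDLY: from level `k₁` on, `b` never drops more than `s = κθ^{k₁}` below `b k₁` (advisory A-lit1g23-1 of the transfer
seat's read of the [III]-side consumer `AveragedAFCarrierAllScales`; cell records GAPS C-lit1g23-1, C-asym2g18-3).  This section
types that reading: the predicate `TailDrop b k₁ s`, the floor `m − s` from a one-sided certified list of depth `k₁`, the
β-level ∕ END sockets of RCC fed with it, and the derivations `AllScalesSeq ⟹ TailDrop` (so §2 is the special case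
`s = κθ^{k₁}`) and `GeomRate ⟹ TailDrop` with `s = c₀θ^{k₁}(1 + θ)` (so RCC §7's margin road is the special case too).  At END
grade the located-unprinted input of the all-scales × constant road is therefore a tail-drop bound at the certified depth —
strictly weaker than `AllScalesRate` ∕ `CauchyRate` ∕ `GeomRate`, which remain what the KERNEL side delivers (§5).  Nothing of
§§1–6 changes. -/

section TailDropRoad

/-- HYPOTHESIS SHAPE (AF-0t, TAIL-DROP form): from level `k₁` on the sequence never drops more than `s` below its level-`k₁`
value, `b k₁ − s ≤ b n` for all `n ≥ k₁`.  The END-grade content of `AllScalesSeq` on the constant-remainder roads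
(`AllScalesSeq.tailDrop`); one level, one side, no `θ`, no limit. [folklore] -/
def TailDrop (b : ℕ → ℝ) (k₁ : ℕ) (s : ℝ) : Prop := ∀ n, k₁ ≤ n → b k₁ - s ≤ b n

namespace TailDrop

variable {b : ℕ → ℝ} {k₁ : ℕ} {s : ℝ}

/-- The drop budget is non-negative (`n = k₁`). [folklore] -/
theorem nonneg (h : TailDrop b k₁ s) : 0 ≤ s := by
  have := h k₁ le_rfl
  linarith

/-- Monotone in the budget. [folklore] -/
theorem mono (h : TailDrop b k₁ s) {s' : ℝ} (hs : s ≤ s') : TailDrop b k₁ s' := fun n hn => by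
  linarith [h n hn]

/-- Transport along a pointwise equality of sequences. [folklore] -/
theorem congr (h : TailDrop b k₁ s) {b' : ℕ → ℝ} (hb : ∀ k, b' k = b k) : TailDrop b' k₁ s := fun n hn => by
  rw [hb, hb]; exact h n hn

/-- **THE FLOOR from a tail drop at depth `k₁` and a ONE-SIDED certified list of depth `k₁`**: `m ≤ b k` for `k ≤ k₁` and
`TailDrop b k₁ s` ⟹ `m − s ≤ b k` for EVERY `k` (below `k₁` by `0 ≤ s`, from `k₁` on through `b k₁ ≥ m`). [folklore] -/
theorem floor_of_list (h : TailDrop b k₁ s) {m : ℝ} (hlist : ∀ k, k ≤ k₁ → m ≤ b k) : ∀ k, m - s ≤ b k := by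
  intro k
  rcases le_or_gt k k₁ with hk | hk
  · linarith [hlist k hk, h.nonneg]
  · linarith [hlist k₁ le_rfl, h k hk.le]

/-- Positivity at all scales from the gap `s < m`. [folklore] -/
theorem pos_all_of_list (h : TailDrop b k₁ s) {m : ℝ} (hlist : ∀ k, k ≤ k₁ → m ≤ b k) (hgap : s < m) :
    ∀ k, 0 < b k := fun k => by
  linarith [h.floor_of_list hlist k]

end TailDrop

/-- **ALL-SCALES ⟹ TAIL DROP at every depth, budget `κθ^{k₁}`** — the instance `k = k₁` of `AllScalesSeq`, lower half of the
absolute value; this is ALL that `AllScalesSeq.lower_of_list` uses of the all-scales hypothesis. [folklore] -/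
theorem AllScalesSeq.tailDrop {b : ℕ → ℝ} {κ θ : ℝ} (h : AllScalesSeq b κ θ) (k₁ : ℕ) :
    TailDrop b k₁ (κ * θ ^ k₁) := fun n hn => by
  obtain ⟨j, rfl⟩ := Nat.exists_eq_add_of_le hn
  have := (_root_.abs_le.mp (h k₁ j)).1
  linarith

/-- Consistency: §1's one-hop floor IS the tail-drop floor with `s = κθ^{k₁}` (same statement, re-derived; no new declaration). -/
example {b : ℕ → ℝ} {κ θ m : ℝ} {k₁ : ℕ} (h : AllScalesSeq b κ θ) (hlist : ∀ k, k ≤ k₁ → m ≤ b k) :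
    ∀ k, m - κ * θ ^ k₁ ≤ b k :=
  (h.tailDrop k₁).floor_of_list hlist

/-- **TWO-ENDED GEOMETRIC RATE ⟹ TAIL DROP, budget `c₀θ^{k₁}(1 + θ)`** (`0 ≤ θ ≤ 1`; through `allScalesSeq_of_geomRate`): RCC §7's
margin-road floor `m − c₀θ^{k₁}(1 + θ)` is the tail-drop floor of this budget. [folklore] -/
theorem tailDrop_of_geomRate {b : ℕ → ℝ} {binf c₀ θ : ℝ} (h : GeomRate b binf c₀ θ) (hθ0 : 0 ≤ θ) (hθ1 : θ ≤ 1)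
    (k₁ : ℕ) : TailDrop b k₁ (c₀ * (1 + θ) * θ ^ k₁) :=
  (allScalesSeq_of_geomRate h hθ0 hθ1).tailDrop k₁

/-- **ONE-STEP CAUCHY RATE ⟹ TAIL DROP, budget `(c/(1 − θ))θ^{k₁}`** (`0 ≤ θ < 1`; through `allScalesSeq_of_cauchyRate`). [folklore] -/
theorem tailDrop_of_cauchyRate {b : ℕ → ℝ} {c θ : ℝ} (h : CauchyRate b c θ) (hθ0 : 0 ≤ θ) (hθ1 : θ < 1) (k₁ : ℕ) :
    TailDrop b k₁ (c / (1 - θ) * θ ^ k₁) :=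
  (allScalesSeq_of_cauchyRate h hθ0 hθ1).tailDrop k₁

variable {β : HBeta}

/-- **β-LEVEL FLOOR, tail drop × one-sided list × constant remainder**: `BetaLowerH (m − s − r) γ₀ β` on the box `γ₀` of the
remainder hypothesis, threshold scale `0` (RCC's `betaLowerH_of_floor_const` fed with `TailDrop.floor_of_list`).
[cite: Balaban1987RG1, (2.12)–(2.14) p.268] -/
theorem betaLowerH_of_tailDropConst (S : B12Beta.OneLoopSplit β) {γ₀ s r m : ℝ} {k₁ : ℕ} (htail : TailDrop S.β0 k₁ s)
    (hlist : ∀ k, k ≤ k₁ → m ≤ S.β0 k) (hrem : RemainderConst S γ₀ r) : BetaLowerH (m - s - r) γ₀ β :=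
  betaLowerH_of_floor_const S (htail.floor_of_list hlist) hrem

/-- **Discrete asymptotic freedom `BetaAFH β`, tail drop × constant** (witness box `γ₀`, constant `m − s − r`, ONE condition
`r < m − s`). [cite: Balaban1987RG1, Thm 2 p.259 (the role of (0.31))] -/
theorem betaAFH_of_tailDropConst (S : B12Beta.OneLoopSplit β) {γ₀ s r m : ℝ} {k₁ : ℕ} (hγ₀ : 0 < γ₀)
    (htail : TailDrop S.β0 k₁ s) (hlist : ∀ k, k ≤ k₁ → m ≤ S.β0 k) (hrem : RemainderConst S γ₀ r) (hr : r < m - s) :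
    BetaAFH β :=
  betaAFH_of_floor_const S hγ₀ (htail.floor_of_list hlist) hrem hr

/-- **THEOREM 2 AS PRINTED, tail drop × one-sided list × constant remainder** — binders: DAG, `1 < L`, `S`,
`htail : TailDrop S.β0 k₁ s`, `hlist`, `hrem : RemainderConst S γ₀ r`, the ONE condition `r < m − s`, (C), (U).  §2's
`thm2Printed_of_allScalesConst` is the case `htail := hall.tailDrop k₁`. [cite: Balaban1987RG1, Thm 2 p.259 with (0.31)] -/
theorem thm2Printed_of_tailDropConst {C : B12.Construction} (hgen : ForwardGenerated C β) {L : ℝ} (hL : 1 < L)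
    (S : B12Beta.OneLoopSplit β) {γ₀ s r β' m : ℝ} {k₁ : ℕ} (hγ₀ : 0 < γ₀) (htail : TailDrop S.β0 k₁ s)
    (hlist : ∀ k, k ≤ k₁ → m ≤ S.β0 k) (hrem : RemainderConst S γ₀ r) (hr : r < m - s)
    (hcont : BetaContH γ₀ β) (hup : BetaUpperH β' γ₀ β) : B12.Thm2Printed C L :=
  thm2Printed_of_floor_const hgen hL S hγ₀ (htail.floor_of_list hlist) hrem hr hcont hup

/-- **END, tail drop × one-sided list × constant remainder** (binders as above without `L`). [cite: Balaban1987RG1, Thm 2 p.259 (first sentence)] -/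
theorem endpointExistence_of_tailDropConst {C : B12.Construction} (hgen : ForwardGenerated C β)
    (S : B12Beta.OneLoopSplit β) {γ₀ s r β' m : ℝ} {k₁ : ℕ} (hγ₀ : 0 < γ₀) (htail : TailDrop S.β0 k₁ s)
    (hlist : ∀ k, k ≤ k₁ → m ≤ S.β0 k) (hrem : RemainderConst S γ₀ r) (hr : r < m - s)
    (hup : BetaUpperH β' γ₀ β) (hcont : BetaContH γ₀ β) : EndpointExistence C :=
  endpointExistence_of_floor_const hgen S hγ₀ (htail.floor_of_list hlist) hrem hr hup hcont

/-- **THEOREM 2 AS PRINTED, tail drop × constant, (U) DERIVED from a level CEILING** `S.β0 k ≤ M` (RCUD's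
`betaUpperH_of_ceiling_const`; `β′ = M + r`): the END-grade content of the pair (`hall` for the floor, `hall` at level `0` for
the derived ceiling) is (tail drop at depth `k₁`, a uniform ceiling) — no `hup`. [cite: Balaban1987RG1, Thm 2 p.259 with (0.31)] -/
theorem thm2Printed_of_tailDropCeilingConst {C : B12.Construction} (hgen : ForwardGenerated C β) {L : ℝ} (hL : 1 < L)
    (S : B12Beta.OneLoopSplit β) {γ₀ s r M m : ℝ} {k₁ : ℕ} (hγ₀ : 0 < γ₀) (htail : TailDrop S.β0 k₁ s)
    (hlist : ∀ k, k ≤ k₁ → m ≤ S.β0 k) (hceil : ∀ k, S.β0 k ≤ M) (hrem : RemainderConst S γ₀ r) (hr : r < m - s)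
    (hcont : BetaContH γ₀ β) : B12.Thm2Printed C L :=
  thm2Printed_of_tailDropConst hgen hL S hγ₀ htail hlist hrem hr hcont (betaUpperH_of_ceiling_const S hceil hrem)

/-- Consistency: §2's (U)-derived END is the case `htail := hall.tailDrop k₁`, `hceil := hall.ceiling_zero` (`M = β⁰_1 + κ`). -/
example {C : B12.Construction} (hgen : ForwardGenerated C β) {L : ℝ} (hL : 1 < L)
    (S : B12Beta.OneLoopSplit β) {γ₀ κ θ r m : ℝ} {k₁ : ℕ} (hγ₀ : 0 < γ₀) (hall : AllScalesSeq S.β0 κ θ)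
    (hlist : ∀ k, k ≤ k₁ → m ≤ S.β0 k) (hrem : RemainderConst S γ₀ r) (hr : r < m - κ * θ ^ k₁)
    (hcont : BetaContH γ₀ β) : B12.Thm2Printed C L :=
  thm2Printed_of_tailDropCeilingConst hgen hL S hγ₀ (hall.tailDrop k₁) hlist hall.ceiling_zero hrem hr hcont

namespace Witness

/-- On the oscillating split the tail drop at depth `0` has budget `1/2` (`β⁰_1 = 5/4`, trough `3/4`). [folklore] -/
theorem tailDrop_splitOsc : TailDrop splitOsc.β0 0 (1 / 2) := by
  simpa using allScalesSeq_splitOsc.tailDrop 0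

/-- … and at depth `1` (a trough, `β⁰_2 = 3/4`) budget `0`: certifying ONE LEVEL DEEPER removes the oscillation budget from the
floor entirely (`m = 3/4`, `s = 0`), which no depth does on the all-scales form (`κθ^{k₁} = 1/2` for every `k₁` at `θ = 1`). [folklore] -/
theorem tailDrop_splitOsc_one : TailDrop splitOsc.β0 1 0 := fun n hn => by
  show 1 + (-1 : ℝ) ^ 1 / 4 - 0 ≤ 1 + (-1 : ℝ) ^ n / 4
  have h : -1 ≤ (-1 : ℝ) ^ n := by
    have := abs_le.mp (le_of_eq (by rw [abs_pow, abs_neg, abs_one, one_pow] : |(-1 : ℝ) ^ n| = 1))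
    exact this.1
  norm_num
  linarith

/-- The certified list one level deeper, `k₁ = 1`: `3/4 ≤ β⁰_1 = 5/4` and `3/4 ≤ β⁰_2 = 3/4`. [folklore] -/
theorem list_splitOsc_one : ∀ k, k ≤ 1 → (3 / 4 : ℝ) ≤ splitOsc.β0 k := fun k hk => by
  show (3 / 4 : ℝ) ≤ 1 + (-1 : ℝ) ^ k / 4
  interval_cases k <;> norm_num

/-- `BetaAFH oscFamily` from depth `1` on the tail-drop road: constant `3/4 − 0 − 0 = 3/4` — the same slope as §6's depth-`0`
all-scales road (`eventualFormOsc.b = 3/4`), reached with budget `0` instead of `1/2`. [folklore] -/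
theorem betaAFH_oscFamily_tailDrop : BetaAFH oscFamily :=
  betaAFH_of_tailDropConst splitOsc (γ₀ := 1) (m := 3 / 4) one_pos tailDrop_splitOsc_one list_splitOsc_one
    remainderConst_splitOsc (by norm_num)

end Witness

end TailDropRoad

end

end Literature.MathematicalPhysics.QuantumFieldTheory.Balaban1983to89.Beta.RemainderConstAllScales
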